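import Literature.AlgebraicGeometry.Motives.RelativePeriods
import Literature.AlgebraicGeometry.Motives.VarietiesProperProofs
import Literature.AlgebraicGeometry.Motives.VarietiesUnitProofs
import Literature.AlgebraicGeometry.Motives.VarietiesProjectiveSpaceProofs
import Literature.AlgebraicGeometry.Motives.BaseChangeProofs
import Literature.AlgebraicTopology.SingularHomology.UniversalCoefficientsField
import HarnessLib

/-!
# Discharged facts: `(Spec k, ∅)` and `(X, ∅)` (`X` smooth projective) are pairs of varieties; rational numbers are cohomological periods; periods of `X` are periods of `(X, ∅)`

`Literature.AlgebraicGeometry.Motives.RelativePeriods` records as named facts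
(`Literature.SchemePair.isVarietyPair_ofScheme_unit : Prop` and
`Literature.IsSmoothProjective.isVarietyPair_ofScheme : Prop`) that the pair `(Spec k, ∅)` attached to the
monoidal unit `𝟙_ (SchemeOver k)` and, more generally, the pair `(X, ∅)` attached to a smooth
projective `k`-variety `X` are *pairs of varieties* (`Literature.AlgebraicGeometry.Motives.SchemePair.IsVarietyPair`: the ambient
`k`-scheme is separated, locally of finite type and quasi-compact over `k`). This file proves both
(`Literature.AlgebraicGeometry.Motives.SchemePair.isVarietyPair_ofScheme_unit_holds`,
`Literature.AlgebraicGeometry.Motives.IsSmoothProjective.isVarietyPair_ofScheme_holds`), so users holding the facts as hypotheses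
can discharge them. No statement of `RelativePeriods` is changed.

## Proofs

* `(Spec k, ∅)`: the structure morphism of `𝟙_ (SchemeOver k)` is `𝟙 (Spec k)` (Mathlib
  `CategoryTheory.Over.tensorUnit_hom`, a `rfl` lemma). An identity is a closed immersion of
  noetherian schemes, hence proper (Hartshorne II Cor. 4.8(a)), i.e. separated, of finite type
  (locally of finite type and quasi-compact) and universally closed (Hartshorne II §4, Definition
  of proper morphisms, p. 100). In Mathlib the three properties hold for every isomorphism and are
  found by instance search.
* `(X, ∅)` with `X` smooth projective of dimension `n`: `X → Spec k` is proper (Hartshorne II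
  Thm. 4.9; the named fact `Literature.AlgebraicGeometry.Motives.IsSmoothProjective.isProper`, discharged in
  `Literature.AlgebraicGeometry.Motives.VarietiesProperProofs` as
  `Literature.AlgebraicGeometry.Motives.IsSmoothProjective.isProper_holds`), hence separated and of finite type (Hartshorne II §4,
  Definition p. 100); Mathlib's `IsProper` extends `IsSeparated`, `UniversallyClosed`,
  `LocallyOfFiniteType`, and universally closed morphisms are quasi-compact (Stacks 04XU).

It also discharges the named fact
`Literature.AlgebraicGeometry.Motives.RelativePeriodData.ratCast_mem_cohomologicalPeriods`
(`R.ratCast_mem_cohomologicalPeriods σ : ∀ q : ℚ, (q : ℂ) ∈ R.cohomologicalPeriods σ`) as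
`Literature.AlgebraicGeometry.Motives.RelativePeriodData.ratCast_mem_cohomologicalPeriods_holds`:
every rational number is a cohomological period of `k` along every `σ : k →+* ℂ`
(Huber–Müller-Stach 2017, Def. 11.3.1 and Example 11.3.3 with `n = j = 0`: the period set of the
vertex `(ℙ⁰_k = Spec k, ∅, 0)` is `k*`, together with `0`).

* `q ∈ ℚ` is the period `∫_γ ω` of the pair `(Spec k, ∅)` in degree `0` with `ω = 1 ∈ H⁰_dR(Spec k)`
  and `γ = q · [pt] ∈ H₀((Spec k)_σ(ℂ); ℚ)`, `pt` the complex point of `(Spec k)_σ ≅ Spec ℂ`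
  (`AlgPoints.baseChangeEquiv`). By the field `pairing_ofScheme` of `RelativePeriodData` (for the
  smooth projective `Spec k`, `isSmoothProjective_unit_holds`) the pairing is the comparison `P.iso σ`
  followed by the Kronecker pairing; `P.iso_one` (`iso (1 ⊗ 1) = 1 ⊗ 1`) and `B.iso_one` (the unit
  of the Weil cohomology `B.W` is the singular unit `1 ∈ H⁰`) reduce it to `⟨1, q · [pt]⟩ • 1`, and
  `⟨1, q · [pt]⟩ = ε(1 ⌢ q · [pt]) = ε(q · [pt]) = q` (Hatcher 2002, §3.3 p. 249, `1 ⌢ c = c`, and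
  §2.1, proof of Prop. 2.7, the augmentation `ε`), recorded for an arbitrary space as
  `Literature.AlgebraicGeometry.Motives.exists_kroneckerPairing_one_eq`.

## Periods of `X` are periods of the pair `(X, ∅)`

Finally, the file discharges the named fact
`Literature.AlgebraicGeometry.Motives.RelativePeriodData.periodSetOf_subset_periodsOfPair`
(`RelativePeriods.lean`) as
`Literature.AlgebraicGeometry.Motives.RelativePeriodData.periodSetOf_subset_periodsOfPair_holds`:
for `X` smooth projective over `k` and `σ : k →+* ℂ`, the periods of `Hⁱ(X)` along `σ` in the
sense of the period realization `P` (`P.periodSetOf σ X i`: the numbers `φ_ℂ(iso_σ(1 ⊗ ω))`,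
`ω ∈ Hⁱ_dR(X)`, `φ ∈ Hⁱ_B(X_σ)^∨` — the "pairing point of view" on the periods of the object
`(Hⁱ_dR(X), Hⁱ_B(X_σ), iso_σ)` of `(k, ℚ)-Vect`, Huber–Müller-Stach 2017, Remark 11.2.2 (1)) are
periods of the pair `(X, ∅)` for the relative period data `R` (`R.periodsOfPair σ (X, ∅) i`: the
image of the period pairing `Hⁱ_dR × Hᵢ^sing → ℂ`, Huber–Müller-Stach 2017, Def. 11.3.1 (1)).

Proof, following Huber–Müller-Stach 2017, Def. 5.3.1 (the period pairing is
`(ω, γ) ↦ γ(per(ω))`, "where we view classes in singular homology as linear forms on singular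
cohomology"): the field `RelativePeriodData.pairing_ofScheme` says exactly this for `(X, ∅)`,
`∫_γ ω = ⟨iso_σ(1 ⊗ ω), γ⟩` with `⟨-, -⟩` the Kronecker pairing; so it remains to write every
`φ ∈ Hⁱ_B(X_σ)^∨ ≅ Hⁱ(X_σ(ℂ); ℚ)^∨` as `⟨-, γ⟩`. Now `X_σ` is smooth projective
(`IsSmoothProjective.baseChangeHom_holds`, Liu 2002 Ex. 3.1.10 / Prop. 4.3.38), so
`Hⁱ_B(X_σ) ≅ Hⁱ(X_σ(ℂ); ℚ)` is finite-dimensional (Weil cohomology axiom (A), `W.finite_obj`, and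
`B.isoObj`); by universal coefficients over a field `Hⁱ(X_σ(ℂ); ℚ) ≅ Hᵢ(X_σ(ℂ); ℚ)^∨`
(`kroneckerPairing_bijective_of_field`, Hatcher 2002 Thm. 3.2 with p. 198), hence `Hᵢ` is
finite-dimensional (`Module.finite_dual_iff`) and the Kronecker pairing is perfect
(`isPerfPair_kroneckerPairing_of_field_holds`), in particular `γ ↦ ⟨-, γ⟩` is onto `(Hⁱ)^∨`.
The numbering of Huber–Müller-Stach 2017 (Ch. 5, Ch. 11) was checked against the authors' 2015
drafts of Part I (Def. 5.3.1, p. 104 of the draft) and Part III (there Ch. 9 = published Ch. 11: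
Remark 9.2.2, Def. 9.3.1, pp. 3–4 and 6) and against the cross-references "[HMS17, Chapter 5]"
(period pairing, Thm. 3.25), "[HMS17, Section 11.2]" and "[HMS17, Theorem 11.4.2]" of
Huber–Wüstholz, *Transcendence and Linear Relations of 1-Periods* (2022).

## References

* R. Hartshorne, *Algebraic Geometry*, GTM 52, Springer (1977), doi:10.1007/978-1-4757-3849-0:
  Ch. II §4, Definition of proper morphisms (p. 100), Cor. 4.8(a) (p. 102), Thm. 4.9 (p. 103).
  [Hartshorne1977]
* The Stacks project, Tag 04XU (universally closed morphisms are quasi-compact). [StacksProject]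
* A. Huber, S. Müller-Stach, *Periods and Nori Motives*, Ergebnisse 65, Springer (2017),
  doi:10.1007/978-3-319-50926-6: Ch. 11, Def. 11.3.1 (periods of a vertex `(X, D, j)`, `𝒫^eff(k)`),
  Example 11.3.3, Prop. 11.1.7. [HuberMullerStachPeriods2017] — read in the authors' draft of
  Part III (4 Aug 2015), where these are Def. 9.3.1, Example 9.3.3, Prop. 9.1.7 (pp. 2, 6–7).
  [HuberMullerStachPeriodsIII2015]
  Also used: Def. 5.3.1 (period isomorphism and period pairing, homology classes as linear forms on
  cohomology), Remark 11.2.2 (1) (periods of an object of `(k, ℚ)-Vect` as the values `λ(φ_ℂ(v))`),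
  Def. 11.3.1 (1) (periods of `(X, D, j)` = image of the period pairing).
* A. Hatcher, *Algebraic Topology*, CUP (2002), §2.1 (proof of Prop. 2.7) and §3.3 (p. 249). [Hatcher2002]
  §3.1, Thm. 3.2 (p. 195) with p. 198 (universal coefficients over a field). [HatcherAT2002]
* Q. Liu, *Algebraic Geometry and Arithmetic Curves*, Oxford GTM 6 (2002), Ex. 3.1.10 and
  Prop. 4.3.38 (base change of smooth projective varieties). [Liu2002]
-/

universe u v

open CategoryTheory AlgebraicGeometry MonoidalCategory

namespace Literature.AlgebraicGeometry.Motives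

namespace SchemePair

variable {k : Type u} [Field k]

/-- Discharge of the named fact `Literature.AlgebraicGeometry.Motives.SchemePair.isVarietyPair_ofScheme_unit`: the point
`(Spec k, ∅)` is a pair of varieties. The structure morphism of `𝟙_ (SchemeOver k)` is
`𝟙 (Spec k)` (definitionally, `CategoryTheory.Over.tensorUnit_hom`), a closed immersion of
noetherian schemes, hence proper (Hartshorne II Cor. 4.8(a)): separated, of finite type (locally
of finite type and quasi-compact) and universally closed (Hartshorne II §4, Definition p. 100).
[cite: Hartshorne1977, Ch. II, Cor. 4.8(a) (p. 102) and Ch. II §4 Definition of proper morphisms (p. 100)] -/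
theorem isVarietyPair_ofScheme_unit_holds : isVarietyPair_ofScheme_unit (k := k) :=
  ⟨inferInstanceAs (IsSeparated (𝟙 (Spec (.of k)))),
    inferInstanceAs (LocallyOfFiniteType (𝟙 (Spec (.of k)))),
    inferInstanceAs (QuasiCompact (𝟙 (Spec (.of k))))⟩

end SchemePair

section SmoothProjective

variable {k : Type u} [Field k]

/-- Discharge of the named fact `Literature.AlgebraicGeometry.Motives.IsSmoothProjective.isVarietyPair_ofScheme`: for `X` a smooth
projective `k`-variety, `(X, ∅)` is a pair of varieties. `X → Spec k` is proper (Hartshorne II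
Thm. 4.9, `Literature.AlgebraicGeometry.Motives.IsSmoothProjective.isProper_holds`), hence separated and of finite type, i.e.
locally of finite type and quasi-compact (Hartshorne II §4, Definition of proper morphisms,
p. 100; universally closed ⇒ quasi-compact, Stacks 04XU).
[cite: Hartshorne1977, Ch. II, Thm. 4.9 (p. 103) and Ch. II §4 Definition of proper morphisms (p. 100)] -/
theorem IsSmoothProjective.isVarietyPair_ofScheme_holds :
    IsSmoothProjective.isVarietyPair_ofScheme (k := k) := by
  intro n X hX
  haveI : IsProper X.hom := IsSmoothProjective.isProper_holds hX
  exact ⟨inferInstanceAs (IsSeparated X.hom), inferInstanceAs (LocallyOfFiniteType X.hom),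
    inferInstanceAs (QuasiCompact X.hom)⟩

end SmoothProjective

/-! ### Rational numbers are cohomological periods -/

section RatPeriods

open Literature.AlgebraicTopology.SingularHomology

/-- On any topological space `E` with a point `e`, every coefficient `m ∈ M` is the value of the
Kronecker pairing of the unit class `1 ∈ H⁰(E; R)` on some class in `H₀(E; M)`, namely on the class
`[m • e]` of the `0`-cycle `m • e`: `⟨1, [m • e]⟩ = ε(1 ⌢ [m • e]) = ε [m • e] = m` (Hatcher 2002,
§3.3, p. 249, `1 ⌢ c = c`, and §2.1, proof of Prop. 2.7, the augmentation `ε(∑ mᵢ xᵢ) = ∑ mᵢ`).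
A small addition to the G04 API (`one_capProduct`, `singularHomology.ε_homologyπ`,
`singularChainComplex.augment_single`), used for `ratCast_mem_cohomologicalPeriods_holds`.
[cite: Hatcher2002, §2.1 proof of Prop. 2.7 and §3.3 p. 249] -/
theorem exists_kroneckerPairing_one_eq (R : Type v) [CommRing R] (M : Type v) [AddCommGroup M]
    [Module R M] {E : Type u} [TopologicalSpace E] (e : E) (m : M) :
    ∃ c : singularHomology R M E 0,
      kroneckerPairing R M E 0 (singularCohomology.one R E) c = m := by
  -- the `0`-simplex at `e` and the `0`-cycle `m • e`
  let s : SingularSimplex E 0 :=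
    (SingularSimplex.toContinuousMap (X := E) (n := 0)).symm (ContinuousMap.const _ e)
  let L : (singularChainComplex R M E).X 0 ⟶ singularChainComplex.cycles R M E 0 :=
    (singularChainComplex R M E).liftCycles (𝟙 _) 0 (by simp) (by simp)
  have hL : singularChainComplex.iCycles R M E 0 (L (singularChainComplex.single (R := R) s m)) =
      singularChainComplex.single (R := R) s m := by
    change (L ≫ singularChainComplex.iCycles R M E 0) _ = _
    rw [HomologicalComplex.liftCycles_i]
    rfl
  refine ⟨(singularChainComplex R M E).homologyπ 0 (L (singularChainComplex.single (R := R) s m)), ?_⟩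
  rw [kroneckerPairing_apply, one_capProduct, singularHomology.ε_homologyπ, hL,
    singularChainComplex.augment_single]

namespace RelativePeriodData

variable {k : Type} [Field k] [CharZero k] {P : PeriodRealization k}

/-- Discharge of the named fact
`Literature.AlgebraicGeometry.Motives.RelativePeriodData.ratCast_mem_cohomologicalPeriods`: every
rational number `q` is a cohomological period of `k` along `σ`. It is the period `∫_γ ω` of the pair
`(Spec k, ∅)` (a pair of varieties, `SchemePair.isVarietyPair_ofScheme_unit_holds`) in degree `0`, with
`ω = 1 ∈ H⁰_dR(Spec k)` and `γ = q · [pt] ∈ H₀((Spec k)_σ(ℂ); ℚ)`, `pt` the complex point of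
`(Spec k)_σ ≅ Spec ℂ`: by `pairing_ofScheme` (for the smooth projective `Spec k`,
`isSmoothProjective_unit_holds`), `P.iso_one` and `B.iso_one`,
`∫_γ 1 = ⟨iso_σ(1 ⊗ 1), γ⟩ = ⟨1, q · [pt]⟩ · 1 = q` (`exists_kroneckerPairing_one_eq`). This is
Huber–Müller-Stach 2017, Def. 11.3.1 with Example 11.3.3 for `n = j = 0` (the vertex
`(ℙ⁰_k = Spec k, ∅, 0)` has period set `k* ⊇ ℚ*`, and `0` is always a period); in the 2015 draft of
Part III these are Def. 9.3.1 and Example 9.3.3 (pp. 6–7), cf. also the proof of Prop. 9.1.7 = 11.1.7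
("the quadruple `(𝔸¹, {0, 1}, dt, [0, 1])` has period `1`", p. 2).
[cite: HuberMullerStachPeriods2017, Def. 11.3.1 and Example 11.3.3 (n = j = 0)] -/
theorem ratCast_mem_cohomologicalPeriods_holds (R : RelativePeriodData P) (σ : k →+* ℂ) :
    R.ratCast_mem_cohomologicalPeriods σ := by
  intro q
  have hX : IsSmoothProjective 0 (𝟙_ (SchemeOver k)) := isSmoothProjective_unit_holds k
  -- the complex point of `(Spec k)_σ ≅ Spec ℂ`
  let pt : ComplexPoints ((baseChangeHom σ).obj (𝟙_ (SchemeOver k))) :=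
    AlgPoints.baseChangeEquiv σ (𝟙_ (SchemeOver k))
      (letI := σ.toAlgebra; SemiCartesianMonoidalCategory.toUnit (specOver k ℂ))
  obtain ⟨c, hc⟩ := exists_kroneckerPairing_one_eq ℚ ℚ pt q
  -- `iso (1 ⊗ 1) = 1 ⊗ 1` and `isoObj 1 = 1`, with the units of `B.W` on `X_σ` written as such (the
  -- fields `iso_one` are stated through `B.comap σ`, definitionally equal)
  have hone : P.iso σ (𝟙_ (SchemeOver k)) 0 (1 ⊗ₜ P.dR.one (𝟙_ (SchemeOver k))) =
      (1 : AlongHom ℂ σ) ⊗ₜ[ℚ] P.B.W.one ((baseChangeHom σ).obj (𝟙_ (SchemeOver k))) :=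
    P.iso_one σ hX
  have hiso : P.B.isoObj ((baseChangeHom σ).obj (𝟙_ (SchemeOver k))) 0
      (P.B.W.one ((baseChangeHom σ).obj (𝟙_ (SchemeOver k)))) =
        bettiOne ((baseChangeHom σ).obj (𝟙_ (SchemeOver k))) :=
    P.B.iso_one _
  refine ⟨SchemePair.ofScheme (𝟙_ (SchemeOver k)), SchemePair.isVarietyPair_ofScheme_unit_holds, 0,
    (R.absEquiv (𝟙_ (SchemeOver k)) 0).symm (P.dR.one _),
    (relativeSingularHomology.ofAbsolute ℚ ℚ (ComplexPoints ((baseChangeHom σ).obj (𝟙_ (SchemeOver k))))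
      ((SchemePair.ofScheme (𝟙_ (SchemeOver k))).complexPointsSub σ) 0).hom c, ?_⟩
  rw [R.pairing_ofScheme σ hX 0, hone, Module.Dual.baseChange_apply_tmul,
    LinearMap.comp_apply, LinearEquiv.coe_coe, hiso, LinearMap.flip_apply, hc, Algebra.smul_def,
    mul_one, eq_ratCast, map_ratCast]

end RelativePeriodData

end RatPeriods

/-! ### Periods of `X` along `σ` are periods of the pair `(X, ∅)` -/

section PeriodSetOfPair

open Literature.AlgebraicTopology.SingularHomology
open scoped TensorProduct

namespace RelativePeriodData

variable {k : Type} [Field k] [CharZero k] {P : PeriodRealization k} (R : RelativePeriodData P)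
  (σ : k →+* ℂ)

/-- Discharge of the named fact
`Literature.AlgebraicGeometry.Motives.RelativePeriodData.periodSetOf_subset_periodsOfPair`: for `X`
smooth projective over `k`, every period `φ_ℂ(iso_σ(1 ⊗ ω))` of `Hⁱ(X)` along `σ`
(`ω ∈ Hⁱ_dR(X)`, `φ ∈ Hⁱ_B(X_σ)^∨`; Huber–Müller-Stach 2017, Remark 11.2.2 (1), the pairing
description of the periods of `(Hⁱ_dR(X), Hⁱ_B(X_σ), iso_σ) ∈ (k, ℚ)-Vect`) is a period
`∫_γ ω'` of the pair `(X, ∅)` (Huber–Müller-Stach 2017, Def. 11.3.1 (1): the image of the period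
pairing). As in Huber–Müller-Stach 2017, Def. 5.3.1, the period pairing is `(ω, γ) ↦ γ(per(ω))`
with homology classes viewed as linear forms on cohomology: here `pairing_ofScheme` gives
`∫_γ ω = ⟨iso_σ(1 ⊗ ω), γ⟩` (Kronecker pairing), and every `φ` is `⟨-, γ⟩` because `X_σ` is smooth
projective (`IsSmoothProjective.baseChangeHom_holds`), so `Hⁱ_B(X_σ) ≅ Hⁱ(X_σ(ℂ); ℚ)`
(`B.isoObj`) is finite-dimensional (`W.finite_obj`), hence so is `Hᵢ(X_σ(ℂ); ℚ)` (universal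
coefficients over a field, `kroneckerPairing_bijective_of_field`, Hatcher 2002 Thm. 3.2, with
`Module.finite_dual_iff`) and the Kronecker pairing is perfect
(`isPerfPair_kroneckerPairing_of_field_holds`). Take `ω' = absEquiv⁻¹ ω` and the image of `γ` in
`Hᵢ(X_σ(ℂ), ∅)` (`relativeSingularHomology.ofAbsolute`).
[cite: HuberMullerStachPeriods2017, Def. 5.3.1, Remark 11.2.2 (1) and Def. 11.3.1 (1)] -/
theorem periodSetOf_subset_periodsOfPair_holds : R.periodSetOf_subset_periodsOfPair σ := by
  intro n X hX i x hx
  obtain ⟨v, φ, rfl⟩ := P.mem_periodSetOf_iff.mp hx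
  -- `X_σ` is smooth projective, so `Hⁱ_B(X_σ) ≅ Hⁱ(X_σ(ℂ); ℚ) ≅ Hᵢ(X_σ(ℂ); ℚ)^∨` is finite-dimensional
  have hXσ : IsSmoothProjective n ((baseChangeHom σ).obj X) :=
    IsSmoothProjective.baseChangeHom_holds σ hX
  haveI : Module.Finite ℚ (P.B.W.obj ((baseChangeHom σ).obj X) i) := P.B.W.finite_obj hXσ i
  haveI : Module.Finite ℚ (bettiCohomology ((baseChangeHom σ).obj X) i) :=
    Module.Finite.equiv (P.B.isoObj ((baseChangeHom σ).obj X) i)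
  haveI : Module.Finite ℚ
      (Module.Dual ℚ (singularHomology ℚ ℚ (ComplexPoints ((baseChangeHom σ).obj X)) i)) :=
    Module.Finite.equiv (LinearEquiv.ofBijective _
      (kroneckerPairing_bijective_of_field ℚ (ComplexPoints ((baseChangeHom σ).obj X)) i))
  haveI : Module.Finite ℚ (singularHomology ℚ ℚ (ComplexPoints ((baseChangeHom σ).obj X)) i) :=
    (Module.finite_dual_iff ℚ).mp ‹_›
  -- hence the Kronecker pairing is perfect and `φ ∘ isoObj⁻¹ = ⟨-, γ₀⟩` for some `γ₀ ∈ Hᵢ(X_σ(ℂ); ℚ)`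
  haveI : (kroneckerPairing ℚ ℚ (ComplexPoints ((baseChangeHom σ).obj X)) i).IsPerfPair :=
    isPerfPair_kroneckerPairing_of_field_holds i
  obtain ⟨γ₀, hγ₀⟩ :=
    (LinearMap.IsPerfPair.bijective_right
      (kroneckerPairing ℚ ℚ (ComplexPoints ((baseChangeHom σ).obj X)) i)).2
      (φ ∘ₗ (P.B.isoObj ((baseChangeHom σ).obj X) i).symm.toLinearMap)
  have hφ : (kroneckerPairing ℚ ℚ (ComplexPoints ((baseChangeHom σ).obj X)) i).flip γ₀ ∘ₗ
      (P.B.isoObj ((baseChangeHom σ).obj X) i).toLinearMap = φ := by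
    rw [hγ₀]
    exact LinearMap.ext fun a ↦
      congrArg φ ((P.B.isoObj ((baseChangeHom σ).obj X) i).symm_apply_apply a)
  -- `∫_{γ₀} (absEquiv⁻¹ v) = ⟨iso_σ(1 ⊗ v), γ₀⟩ = φ_ℂ(iso_σ(1 ⊗ v))` by `pairing_ofScheme`
  refine ⟨(R.absEquiv X i).symm v,
    (relativeSingularHomology.ofAbsolute ℚ ℚ (ComplexPoints ((baseChangeHom σ).obj X))
      ((SchemePair.ofScheme X).complexPointsSub σ) i).hom γ₀, ?_⟩
  rw [R.pairing_ofScheme σ hX i v γ₀, hφ]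
  -- the two sides now differ only by unfolding `PreWeilCohomology.comap_obj` (`rfl`)
  rfl

end RelativePeriodData

end PeriodSetOfPair

/-! ### The periods of a pair are closed under multiplication by `k` and by `ℚ` -/

section ScalarClosure

open scoped Pointwise

namespace RelativePeriodData

variable {k : Type} [Field k] [CharZero k] {P : PeriodRealization k} (R : RelativePeriodData P)
  {σ : k →+* ℂ}

/-- `∫_γ (a • ω) = σ(a) · ∫_γ ω`: the period pairing is `k`-linear in the de Rham class, with `ℂ`
a `k`-algebra along `σ` (Huber–Müller-Stach 2015, Def. 9.3.1, the pairing
`per : Hʲ_dR(X, D) × Hⱼ^sing(X^an, D^an) → ℂ`; Remark 9.3.2). [cite: HuberMullerStachPeriodsIII2015, Def. 9.3.1 and Remark 9.3.2] -/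
theorem equiv_pairing_smul (Y : SchemePair k) (i : ℕ) (a : k) (ω : R.obj Y i)
    (γ : Y.bettiHomology σ i) :
    AlongHom.equiv σ (R.pairing σ Y i (a • ω) γ) = σ a * AlongHom.equiv σ (R.pairing σ Y i ω γ) := by
  rw [LinearMap.map_smul, LinearMap.smul_apply, Algebra.smul_def, map_mul, AlongHom.equiv_algebraMap]

/-- `∫_{q • γ} ω = q · ∫_γ ω` for `q ∈ ℚ`: the period pairing is `ℚ`-linear in the singular class
(Huber–Müller-Stach 2015, Def. 9.3.1). [cite: HuberMullerStachPeriodsIII2015, Def. 9.3.1] -/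
theorem equiv_pairing_rat_smul (Y : SchemePair k) (i : ℕ) (q : ℚ) (ω : R.obj Y i)
    (γ : Y.bettiHomology σ i) :
    AlongHom.equiv σ (R.pairing σ Y i ω (q • γ)) = q * AlongHom.equiv σ (R.pairing σ Y i ω γ) := by
  rw [LinearMap.map_smul, Rat.smul_def, map_mul, map_ratCast]

/-- **Huber–Müller-Stach 2015, Remark 9.3.2** (= 2017, Remark 11.3.2): the set of periods
`ℙ(X, D, j)` of a pair is closed under multiplication by elements of `k` (embedded by `σ`):
`σ(a) · ∫_γ ω = ∫_γ (a • ω)`. (It is *not* closed under addition in general, loc. cit.; only the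
union `ℙ^eff(k)` over all pairs is a `k`-algebra, by Cor. 9.3.5, which needs disjoint unions and
products of pairs and is not a consequence of the fields of `RelativePeriodData`.)
[cite: HuberMullerStachPeriodsIII2015, Remark 9.3.2] -/
theorem mul_mem_periodsOfPair {Y : SchemePair k} {i : ℕ} (a : k) {x : ℂ}
    (hx : x ∈ R.periodsOfPair σ Y i) : σ a * x ∈ R.periodsOfPair σ Y i := by
  obtain ⟨ω, γ, rfl⟩ := hx
  exact ⟨a • ω, γ, (R.equiv_pairing_smul Y i a ω γ).symm⟩

/-- Remark 9.3.2 of Huber–Müller-Stach 2015 in pointwise form: `σ(a) · ℙ(X, D, j) ⊆ ℙ(X, D, j)`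
for every `a ∈ k`. [cite: HuberMullerStachPeriodsIII2015, Remark 9.3.2] -/
theorem smul_periodsOfPair_subset (Y : SchemePair k) (i : ℕ) (a : k) :
    σ a • R.periodsOfPair σ Y i ⊆ R.periodsOfPair σ Y i := by
  rintro _ ⟨x, hx, rfl⟩
  exact R.mul_mem_periodsOfPair a hx

/-- The set of periods of a pair is closed under negation (`a = -1` in Huber–Müller-Stach 2015,
Remark 9.3.2). [cite: HuberMullerStachPeriodsIII2015, Remark 9.3.2] -/
theorem neg_mem_periodsOfPair {Y : SchemePair k} {i : ℕ} {x : ℂ}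
    (hx : x ∈ R.periodsOfPair σ Y i) : -x ∈ R.periodsOfPair σ Y i := by
  simpa using R.mul_mem_periodsOfPair (-1) hx

/-- The set of periods of a pair is closed under multiplication by rational numbers:
`q · ∫_γ ω = ∫_{q • γ} ω` (Huber–Müller-Stach 2015, Def. 9.3.1 / Remark 9.3.2 with `ℚ ⊆ k`).
[cite: HuberMullerStachPeriodsIII2015, Remark 9.3.2] -/
theorem ratCast_mul_mem_periodsOfPair {Y : SchemePair k} {i : ℕ} (q : ℚ) {x : ℂ}
    (hx : x ∈ R.periodsOfPair σ Y i) : (q : ℂ) * x ∈ R.periodsOfPair σ Y i := by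
  obtain ⟨ω, γ, rfl⟩ := hx
  exact ⟨ω, q • γ, (R.equiv_pairing_rat_smul Y i q ω γ).symm⟩

/-- **Huber–Müller-Stach 2015, Remark 9.3.2** for the union over all pairs of varieties: the set
`ℙ^eff(k)` of cohomological periods of `k` along `σ` is closed under multiplication by `σ(k)`
(the part of "`ℙ^eff(k)` is a `k`-algebra", Cor. 9.3.5 (1), that holds pair by pair).
[cite: HuberMullerStachPeriodsIII2015, Remark 9.3.2 and Cor. 9.3.5 (1)] -/
theorem mul_mem_cohomologicalPeriods (a : k) {x : ℂ} (hx : x ∈ R.cohomologicalPeriods σ) :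
    σ a * x ∈ R.cohomologicalPeriods σ := by
  obtain ⟨Y, hY, i, ω, γ, rfl⟩ := hx
  exact R.periodsOfPair_subset_cohomologicalPeriods hY i
    (R.mul_mem_periodsOfPair a ⟨ω, γ, rfl⟩)

/-- Pointwise form: `σ(a) · ℙ^eff(k) ⊆ ℙ^eff(k)` for every `a ∈ k` (Huber–Müller-Stach 2015,
Remark 9.3.2 / Cor. 9.3.5 (1)). [cite: HuberMullerStachPeriodsIII2015, Remark 9.3.2] -/
theorem smul_cohomologicalPeriods_subset (a : k) :
    σ a • R.cohomologicalPeriods σ ⊆ R.cohomologicalPeriods σ := by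
  rintro _ ⟨x, hx, rfl⟩
  exact R.mul_mem_cohomologicalPeriods a hx

/-- The set of cohomological periods is closed under negation (Huber–Müller-Stach 2015,
Remark 9.3.2 with `a = -1`). [cite: HuberMullerStachPeriodsIII2015, Remark 9.3.2] -/
theorem neg_mem_cohomologicalPeriods {x : ℂ} (hx : x ∈ R.cohomologicalPeriods σ) :
    -x ∈ R.cohomologicalPeriods σ := by
  simpa using R.mul_mem_cohomologicalPeriods (-1) hx

/-- The set of cohomological periods is closed under multiplication by rational numbers
(Huber–Müller-Stach 2015, Remark 9.3.2 with `ℚ ⊆ k`; `ℚ`-linearity of the period pairing in the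
singular class). [cite: HuberMullerStachPeriodsIII2015, Remark 9.3.2] -/
theorem ratCast_mul_mem_cohomologicalPeriods (q : ℚ) {x : ℂ} (hx : x ∈ R.cohomologicalPeriods σ) :
    (q : ℂ) * x ∈ R.cohomologicalPeriods σ := by
  obtain ⟨Y, hY, i, ω, γ, rfl⟩ := hx
  exact R.periodsOfPair_subset_cohomologicalPeriods hY i
    (R.ratCast_mul_mem_periodsOfPair q ⟨ω, γ, rfl⟩)

/-- The period space `ℙ⟨X, D, j⟩` (the `ℚ`-span of `ℙ(X, D, j)`, Huber–Müller-Stach 2015,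
Def. 9.3.1 (2)) is stable under multiplication by `σ(k)`, since `ℙ(X, D, j)` is (Remark 9.3.2).
[cite: HuberMullerStachPeriodsIII2015, Def. 9.3.1 (2) and Remark 9.3.2] -/
theorem mul_mem_periodSpaceOfPair {Y : SchemePair k} {i : ℕ} (a : k) {x : ℂ}
    (hx : x ∈ R.periodSpaceOfPair σ Y i) : σ a * x ∈ R.periodSpaceOfPair σ Y i := by
  induction hx using Submodule.span_induction with
  | mem x hx => exact Submodule.subset_span (R.mul_mem_periodsOfPair a hx)
  | zero => simp
  | add x y _ _ hx hy =>
    rw [mul_add]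
    exact add_mem hx hy
  | smul q x _ hx =>
    rw [mul_smul_comm]
    exact Submodule.smul_mem _ q hx

end RelativePeriodData

end ScalarClosure

/-! ### Periods of a pair in terms of a period matrix -/

section PeriodMatrix

namespace RelativePeriodData

variable {k : Type} [Field k] [CharZero k] {P : PeriodRealization k} (R : RelativePeriodData P)
  {σ : k →+* ℂ} {ι₁ ι₂ : Type*} [Fintype ι₁] [Fintype ι₂]

/-- A period in coordinates: for a `k`-basis `b₁` of `Hⁱ(Y) = Hⁱ_dR(X, D)` and a `ℚ`-basis `b₂` of
`Hᵢ(X_σ(ℂ), D_σ(ℂ); ℚ)`, `∫_γ ω = ∑_{a, b} σ(ω_a) γ_b ∫_{b₂ b} (b₁ a)`, where `ω = ∑ ω_a b₁ a`,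
`γ = ∑ γ_b b₂ b` and `(∫_{b₂ b} b₁ a)_{a, b}` is the period matrix (Huber–Müller-Stach 2015,
Def. 9.2.1 and §9.2, p. 6: "the entries of the period matrix … are the coefficients of `φ_ℂ(y_j)`
in the basis `x_l`"; Def. 9.3.1 for pairs). [cite: HuberMullerStachPeriodsIII2015, Def. 9.2.1 and Def. 9.3.1] -/
theorem equiv_pairing_eq_sum_periodMatrixOfPair (Y : SchemePair k) (i : ℕ)
    (b₁ : Module.Basis ι₁ k (R.obj Y i)) (b₂ : Module.Basis ι₂ ℚ (Y.bettiHomology σ i))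
    (ω : R.obj Y i) (γ : Y.bettiHomology σ i) :
    AlongHom.equiv σ (R.pairing σ Y i ω γ) =
      ∑ a, ∑ b, σ (b₁.repr ω a) * (b₂.repr γ b : ℂ) * R.periodMatrixOfPair σ Y i b₁ b₂ a b := by
  conv_lhs => rw [← b₁.sum_repr ω, ← b₂.sum_repr γ]
  rw [map_sum (R.pairing σ Y i), LinearMap.sum_apply, map_sum (AlongHom.equiv σ)]
  refine Finset.sum_congr rfl fun a _ ↦ ?_
  rw [equiv_pairing_smul, map_sum (R.pairing σ Y i (b₁ a)), map_sum (AlongHom.equiv σ),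
    Finset.mul_sum]
  refine Finset.sum_congr rfl fun b _ ↦ ?_
  rw [equiv_pairing_rat_smul, mul_assoc]
  rfl

/-- Every period of the pair `Y` in degree `i` lies in the `σ(k)`-span of the entries of any
period matrix: `ℙ(X, D, j) ⊆ ⟨period matrix entries⟩_{σ(k)}` (Huber–Müller-Stach 2015,
Def. 9.2.1: `ℙ⟨V⟩` is the `k`-subspace of `ℂ` generated by the entries of the period matrix;
Def. 9.3.1 (2)–(3) for pairs). [cite: HuberMullerStachPeriodsIII2015, Def. 9.2.1 and Def. 9.3.1 (2)–(3)] -/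
theorem periodsOfPair_subset_span_periodMatrixOfPair (Y : SchemePair k) (i : ℕ)
    (b₁ : Module.Basis ι₁ k (R.obj Y i)) (b₂ : Module.Basis ι₂ ℚ (Y.bettiHomology σ i)) :
    R.periodsOfPair σ Y i ⊆
      Submodule.span σ.fieldRange
        (Set.range fun p : ι₁ × ι₂ ↦ R.periodMatrixOfPair σ Y i b₁ b₂ p.1 p.2) := by
  rintro _ ⟨ω, γ, rfl⟩
  rw [R.equiv_pairing_eq_sum_periodMatrixOfPair Y i b₁ b₂ ω γ]
  refine Submodule.sum_mem _ fun a _ ↦ Submodule.sum_mem _ fun b _ ↦ ?_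
  have hmem : σ (b₁.repr ω a) * (b₂.repr γ b : ℂ) ∈ σ.fieldRange :=
    mul_mem (σ.mem_fieldRange_self _) (RingHom.mem_fieldRange.mpr ⟨b₂.repr γ b, map_ratCast σ _⟩)
  exact Submodule.smul_mem _ (⟨_, hmem⟩ : σ.fieldRange) (Submodule.subset_span ⟨(a, b), rfl⟩)

/-- Hence the `σ(k)`-subspace of `ℂ` spanned by the periods of a pair (the `k`-space of periods
`ℙ⟨X, D, j⟩ · k` of Huber–Müller-Stach 2015, Def. 9.3.1 (3)) is spanned by the entries of a period
matrix and is finite-dimensional, of dimension at most `dim_k Hⁱ(Y) · dim_ℚ Hᵢ(X_σ(ℂ), D_σ(ℂ); ℚ)`,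
as soon as both sides are finite-dimensional (Huber–Müller-Stach 2015, Def. 9.2.1 / §9.2).
[cite: HuberMullerStachPeriodsIII2015, Def. 9.2.1 and Def. 9.3.1 (3)] -/
theorem finrank_span_periodsOfPair_le (Y : SchemePair k) (i : ℕ) [Module.Finite k (R.obj Y i)]
    [Module.Finite ℚ (Y.bettiHomology σ i)] :
    Module.finrank σ.fieldRange (Submodule.span σ.fieldRange (R.periodsOfPair σ Y i)) ≤
      Module.finrank k (R.obj Y i) * Module.finrank ℚ (Y.bettiHomology σ i) := by
  let b₁ := Module.finBasis k (R.obj Y i)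
  let b₂ := Module.finBasis ℚ (Y.bettiHomology σ i)
  let M : Fin (Module.finrank k (R.obj Y i)) × Fin (Module.finrank ℚ (Y.bettiHomology σ i)) → ℂ :=
    fun p ↦ R.periodMatrixOfPair σ Y i b₁ b₂ p.1 p.2
  have hle : Submodule.span σ.fieldRange (R.periodsOfPair σ Y i) ≤
      Submodule.span σ.fieldRange (Set.range M) :=
    Submodule.span_le.mpr (R.periodsOfPair_subset_span_periodMatrixOfPair Y i b₁ b₂)
  haveI : FiniteDimensional σ.fieldRange (Submodule.span (σ.fieldRange) (Set.range M)) :=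
    FiniteDimensional.span_of_finite _ (Set.finite_range M)
  calc Module.finrank σ.fieldRange (Submodule.span σ.fieldRange (R.periodsOfPair σ Y i))
      ≤ Module.finrank σ.fieldRange (Submodule.span σ.fieldRange (Set.range M)) :=
        Submodule.finrank_mono hle
    _ ≤ Fintype.card (Fin (Module.finrank k (R.obj Y i)) ×
          Fin (Module.finrank ℚ (Y.bettiHomology σ i))) := finrank_range_le_card M
    _ = Module.finrank k (R.obj Y i) * Module.finrank ℚ (Y.bettiHomology σ i) := by simp

/-- In particular the `σ(k)`-span of the periods of a pair with finite-dimensional de Rham and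
Betti sides is finite-dimensional over `σ(k)` (Huber–Müller-Stach 2015, Def. 9.2.1 / Def. 9.3.1 (3)).
[cite: HuberMullerStachPeriodsIII2015, Def. 9.2.1 and Def. 9.3.1 (3)] -/
theorem finiteDimensional_span_periodsOfPair (Y : SchemePair k) (i : ℕ)
    [Module.Finite k (R.obj Y i)] [Module.Finite ℚ (Y.bettiHomology σ i)] :
    FiniteDimensional σ.fieldRange (Submodule.span σ.fieldRange (R.periodsOfPair σ Y i)) := by
  let b₁ := Module.finBasis k (R.obj Y i)
  let b₂ := Module.finBasis ℚ (Y.bettiHomology σ i)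
  let M : Fin (Module.finrank k (R.obj Y i)) × Fin (Module.finrank ℚ (Y.bettiHomology σ i)) → ℂ :=
    fun p ↦ R.periodMatrixOfPair σ Y i b₁ b₂ p.1 p.2
  haveI : FiniteDimensional σ.fieldRange (Submodule.span (σ.fieldRange) (Set.range M)) :=
    FiniteDimensional.span_of_finite _ (Set.finite_range M)
  exact Submodule.finiteDimensional_of_le
    (Submodule.span_le.mpr (R.periodsOfPair_subset_span_periodMatrixOfPair Y i b₁ b₂))

end RelativePeriodData

end PeriodMatrix

/-! ### Periods of a pair depend only on its isomorphism class

Huber–Müller-Stach 2015, Def. 9.3.1 (4) forms `ℙ^eff(k)` as the union of the period sets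
`ℙ(X, D, j)` over the *isomorphism classes* of vertices `(X, D, j)`, and Remark 9.2.2 (2) notes that
the set of periods of a subcategory of `(k, ℚ)-Vect` "does not depend on the morphisms". For
relative period data `R` this is the statement that `R.periodsOfPair σ Y i` is invariant under
isomorphisms of pairs, which follows from naturality of the period pairing (`pairing_map`,
`∫_γ f^*ω = ∫_{f_*γ} ω`) alone. More generally (proof of Prop. 9.2.4, loc. cit.: the periods of a
quotient, resp. a subobject, of `V ∈ (k, ℚ)-Vect` are periods of `V`): if `f^*` is onto, the periods
of `Y` are periods of `Y'`; if `f_*` is onto, the periods of `Y'` are periods of `Y`. -/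

section IsoInvariance

namespace SchemePair

variable {k : Type u} [Field k]

/-- Being a pair of varieties is invariant under isomorphism of pairs: an isomorphism `Y ≅ Y'`
of pairs restricts to a `k`-isomorphism `X ≅ X'` of the ambient schemes, and "separated",
"locally of finite type", "quasi-compact" over `k` are stable under composition with
isomorphisms (Hartshorne II §4; in Mathlib the three morphism properties respect isomorphisms).
[cite: HuberMullerStachPeriodsIII2015, Def. 9.3.1 (4) (isomorphism classes of vertices)] -/
theorem IsVarietyPair.of_iso {Y Y' : SchemePair k} (e : Y ≅ Y') (h : Y'.IsVarietyPair) :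
    Y.IsVarietyPair := by
  -- the isomorphism of ambient `k`-schemes underlying `e`
  let eX : Y.X ≅ Y'.X :=
    { hom := e.hom.fX
      inv := e.inv.fX
      hom_inv_id := by rw [← comp_fX, e.hom_inv_id, id_fX]
      inv_hom_id := by rw [← comp_fX, e.inv_hom_id, id_fX] }
  have hX : Y.X.hom = ((Over.forget _).mapIso eX).hom ≫ Y'.X.hom := (Over.w eX.hom).symm
  haveI := h.isSeparated
  haveI := h.locallyOfFiniteType
  haveI := h.quasiCompact
  refine ⟨?_, ?_, ?_⟩
  · rw [hX]
    exact (MorphismProperty.cancel_left_of_respectsIso @IsSeparated _ _).mpr ‹_›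
  · rw [hX]
    exact (MorphismProperty.cancel_left_of_respectsIso @LocallyOfFiniteType _ _).mpr ‹_›
  · rw [hX]
    exact (MorphismProperty.cancel_left_of_respectsIso @QuasiCompact _ _).mpr ‹_›

/-- Isomorphic pairs are simultaneously pairs of varieties.
[cite: HuberMullerStachPeriodsIII2015, Def. 9.3.1 (4) (isomorphism classes of vertices)] -/
theorem isVarietyPair_iff_of_iso {Y Y' : SchemePair k} (e : Y ≅ Y') :
    Y.IsVarietyPair ↔ Y'.IsVarietyPair :=
  ⟨IsVarietyPair.of_iso e.symm, IsVarietyPair.of_iso e⟩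

end SchemePair

namespace RelativePeriodData

variable {k : Type} [Field k] [CharZero k] {P : PeriodRealization k} (R : RelativePeriodData P)
  {σ : k →+* ℂ}

/-- If `f : Y ⟶ Y'` is a morphism of pairs whose pull-back `f^* : Hⁱ(Y') → Hⁱ(Y)` is onto, then
every period of `Y` is a period of `Y'`: `∫_γ f^*ω' = ∫_{f_*γ} ω'` (naturality of the period
pairing; Huber–Müller-Stach 2015, proof of Prop. 9.2.4: the periods of a quotient of an object of
`(k, ℚ)-Vect` are among its periods). [cite: HuberMullerStachPeriodsIII2015, Remark 9.2.2 and proof of Prop. 9.2.4] -/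
theorem periodsOfPair_subset_of_surjective_map {Y Y' : SchemePair k} (f : Y ⟶ Y') (i : ℕ)
    (hf : Function.Surjective (R.map f i)) : R.periodsOfPair σ Y i ⊆ R.periodsOfPair σ Y' i := by
  rintro _ ⟨ω, γ, rfl⟩
  obtain ⟨ω', rfl⟩ := hf ω
  exact R.pairing_map_mem_periodsOfPair f i ω' γ

/-- Dually, if the push-forward `f_* : Hᵢ(X_σ(ℂ), D_σ(ℂ)) → Hᵢ(X'_σ(ℂ), D'_σ(ℂ))` along a morphism of
pairs `f : Y ⟶ Y'` is onto, then every period of `Y'` is a period of `Y`: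
`∫_{f_*γ} ω' = ∫_γ f^*ω'` (Huber–Müller-Stach 2015, proof of Prop. 9.2.4: the periods of a
subobject of an object of `(k, ℚ)-Vect` are among its periods).
[cite: HuberMullerStachPeriodsIII2015, Remark 9.2.2 and proof of Prop. 9.2.4] -/
theorem periodsOfPair_subset_of_surjective_bettiHomology_map {Y Y' : SchemePair k} (f : Y ⟶ Y')
    (i : ℕ) (hf : Function.Surjective (SchemePair.bettiHomology.map σ f i).hom) :
    R.periodsOfPair σ Y' i ⊆ R.periodsOfPair σ Y i := by
  rintro _ ⟨ω', γ', rfl⟩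
  obtain ⟨γ, rfl⟩ := hf γ'
  exact ⟨R.map f i ω', γ, by rw [pairing_map_apply]⟩

/-- Pull-back along an isomorphism of pairs is onto (indeed bijective, `Hⁱ` being a functor).
[folklore] -/
theorem map_surjective_of_iso {Y Y' : SchemePair k} (e : Y ≅ Y') (i : ℕ) :
    Function.Surjective (R.map e.hom i) := fun ω ↦
  ⟨R.map e.inv i ω, by
    rw [← LinearMap.comp_apply, ← R.map_comp, e.hom_inv_id, R.map_id, LinearMap.id_apply]⟩

/-- Pull-back along an isomorphism of pairs is injective. [folklore] -/
theorem map_injective_of_iso {Y Y' : SchemePair k} (e : Y ≅ Y') (i : ℕ) :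
    Function.Injective (R.map e.hom i) := fun ω ω' h ↦ by
  simpa [← LinearMap.comp_apply, ← R.map_comp] using congrArg (R.map e.inv i) h

/-- **Isomorphic pairs have the same periods**: `ℙ(X, D, j)` only depends on the isomorphism class
of the vertex `(X, D, j)` (Huber–Müller-Stach 2015, Def. 9.3.1 (4), where `ℙ^eff(k)` is the union
over isomorphism classes of vertices; Remark 9.2.2 (2)). For relative period data this follows from
naturality of the period pairing alone. [cite: HuberMullerStachPeriodsIII2015, Def. 9.3.1 (4) and Remark 9.2.2 (2)] -/
theorem periodsOfPair_eq_of_iso {Y Y' : SchemePair k} (e : Y ≅ Y') (i : ℕ) :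
    R.periodsOfPair σ Y i = R.periodsOfPair σ Y' i :=
  (R.periodsOfPair_subset_of_surjective_map e.hom i (R.map_surjective_of_iso e i)).antisymm
    (R.periodsOfPair_subset_of_surjective_map e.inv i (R.map_surjective_of_iso e.symm i))

/-- Isomorphic pairs have the same period space `ℙ⟨X, D, j⟩` (Huber–Müller-Stach 2015,
Def. 9.3.1 (2) and (4)). [cite: HuberMullerStachPeriodsIII2015, Def. 9.3.1 (2) and (4)] -/
theorem periodSpaceOfPair_eq_of_iso {Y Y' : SchemePair k} (e : Y ≅ Y') (i : ℕ) :
    R.periodSpaceOfPair σ Y i = R.periodSpaceOfPair σ Y' i := by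
  change Submodule.span ℚ (R.periodsOfPair σ Y i) = Submodule.span ℚ (R.periodsOfPair σ Y' i)
  rw [R.periodsOfPair_eq_of_iso e i]

/-- If `f^* : Hⁱ(Y') → Hⁱ(Y)` is onto then `ℙ⟨Y⟩ ≤ ℙ⟨Y'⟩` (Huber–Müller-Stach 2015, Def. 9.3.1 (2)
with the proof of Prop. 9.2.4). [cite: HuberMullerStachPeriodsIII2015, Def. 9.3.1 (2) and proof of Prop. 9.2.4] -/
theorem periodSpaceOfPair_le_of_surjective_map {Y Y' : SchemePair k} (f : Y ⟶ Y') (i : ℕ)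
    (hf : Function.Surjective (R.map f i)) : R.periodSpaceOfPair σ Y i ≤ R.periodSpaceOfPair σ Y' i :=
  Submodule.span_mono (R.periodsOfPair_subset_of_surjective_map f i hf)

/-- The cohomological periods are unchanged if each pair of varieties is replaced by an isomorphic
pair: for every family of isomorphisms `e Y : Y ≅ Y'` the union of the `ℙ(Y', j)` over all pairs of
varieties `Y` is still `ℙ^eff` (Huber–Müller-Stach 2015, Def. 9.3.1 (3)–(4): `ℙ^eff(k)` is the
union over isomorphism classes of vertices). [cite: HuberMullerStachPeriodsIII2015, Def. 9.3.1 (3)–(4)] -/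
theorem cohomologicalPeriods_eq_iUnion_of_iso (Y' : SchemePair k → SchemePair k)
    (e : ∀ Y, Y ≅ Y' Y) :
    R.cohomologicalPeriods σ =
      ⋃ (Y : SchemePair k) (_ : Y.IsVarietyPair) (i : ℕ), R.periodsOfPair σ (Y' Y) i := by
  ext x
  simp only [mem_cohomologicalPeriods_iff, Set.mem_iUnion]
  constructor
  · rintro ⟨Y, hY, i, ω, γ, rfl⟩
    exact ⟨Y, hY, i, R.periodsOfPair_eq_of_iso (e Y) i ▸ ⟨ω, γ, rfl⟩⟩
  · rintro ⟨Y, hY, i, hx⟩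
    rw [← R.periodsOfPair_eq_of_iso (e Y) i] at hx
    obtain ⟨ω, γ, rfl⟩ := hx
    exact ⟨Y, hY, i, ω, γ, rfl⟩

/-- `ℙ^eff(k)` along `σ` is the union of the period sets `ℙ(X, D, j)` over all pairs of
`k`-varieties and all degrees (Huber–Müller-Stach 2015, Def. 9.3.1 (3)–(4)).
[cite: HuberMullerStachPeriodsIII2015, Def. 9.3.1 (3)–(4)] -/
theorem cohomologicalPeriods_eq_iUnion :
    R.cohomologicalPeriods σ =
      ⋃ (Y : SchemePair k) (_ : Y.IsVarietyPair) (i : ℕ), R.periodsOfPair σ Y i :=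
  R.cohomologicalPeriods_eq_iUnion_of_iso id fun Y ↦ Iso.refl Y

/-- The `ℚ`-space of periods `ℙ⟨S⟩` for `S` = all vertices, i.e. the sum of the period spaces
`ℙ⟨X, D, j⟩` over all pairs of varieties and degrees, is the `ℚ`-span of `ℙ^eff(k)`
(Huber–Müller-Stach 2015, Def. 9.3.1 (2)–(4)). [cite: HuberMullerStachPeriodsIII2015, Def. 9.3.1 (2)–(4)] -/
theorem iSup_periodSpaceOfPair_eq_span_cohomologicalPeriods :
    ⨆ (Y : SchemePair k) (_ : Y.IsVarietyPair) (i : ℕ), R.periodSpaceOfPair σ Y i =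
      Submodule.span ℚ (R.cohomologicalPeriods σ) := by
  simp only [periodSpaceOfPair, cohomologicalPeriods_eq_iUnion, Submodule.span_iUnion]

end RelativePeriodData

end IsoInvariance

/-! ### Periods as entries of period matrices

Huber–Müller-Stach 2015, Def. 9.2.1 defines a period of `V = (V_k, V_ℚ, φ_ℂ) ∈ (k, ℚ)-Vect` as an
entry of a period matrix of `V` *for some choice of bases*, and `ℙ(V)` as these numbers together
with `0`; Remark 9.2.2 (1) observes that `ℙ(V)` is the image of the associated pairing and that the
`k`-space `ℙ⟨V⟩` spanned by the entries of a period matrix does not depend on the bases; §9.3.2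
identifies `ℙ(X, D, j)`, `ℙ⟨X, D, j⟩` with `ℙ(H(X, D, j))`, `ℙ⟨H(X, D, j)⟩`. For relative period
data, whose `periodsOfPair` is *defined* as the image of the pairing, we prove the two descriptions
agree and that the `σ(k)`-span of the entries of a period matrix is independent of the bases. -/

section Entries

namespace RelativePeriodData

variable {k : Type} [Field k] [CharZero k] {P : PeriodRealization k} (R : RelativePeriodData P)
  {σ : k →+* ℂ}

/-- **Huber–Müller-Stach 2015, Def. 9.2.1 = Remark 9.2.2 (1)** for pairs: a complex number is a
period of the pair `Y` in degree `i` (a value `∫_γ ω` of the period pairing) if and only if it is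
`0` or an entry of the period matrix of `Y` with respect to *some* `k`-basis of `Hⁱ(Y)` and some
`ℚ`-basis of `Hᵢ(X_σ(ℂ), D_σ(ℂ); ℚ)` (extend `ω ≠ 0` and `γ ≠ 0` to bases).
[cite: HuberMullerStachPeriodsIII2015, Def. 9.2.1, Remark 9.2.2 (1) and §9.3.2] -/
theorem mem_periodsOfPair_iff_eq_zero_or_exists_basis {Y : SchemePair k} {i : ℕ} {x : ℂ} :
    x ∈ R.periodsOfPair σ Y i ↔ x = 0 ∨
      ∃ (ι₁ ι₂ : Type) (b₁ : Module.Basis ι₁ k (R.obj Y i))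
        (b₂ : Module.Basis ι₂ ℚ (Y.bettiHomology σ i)) (a : ι₁) (b : ι₂),
          x = R.periodMatrixOfPair σ Y i b₁ b₂ a b := by
  constructor
  · rintro ⟨ω, γ, rfl⟩
    by_cases hω : ω = 0
    · exact Or.inl (by simp [hω])
    by_cases hγ : γ = 0
    · exact Or.inl (by simp [hγ])
    have hω' : LinearIndepOn k id ({ω} : Set (R.obj Y i)) := LinearIndepOn.singleton hω
    have hγ' : LinearIndepOn ℚ id ({γ} : Set (Y.bettiHomology σ i)) := LinearIndepOn.singleton hγ
    refine Or.inr ⟨_, _, Module.Basis.extend hω', Module.Basis.extend hγ',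
      ⟨ω, Module.Basis.subset_extend hω' (Set.mem_singleton ω)⟩,
      ⟨γ, Module.Basis.subset_extend hγ' (Set.mem_singleton γ)⟩, ?_⟩
    rw [periodMatrixOfPair, Matrix.of_apply, Module.Basis.extend_apply_self,
      Module.Basis.extend_apply_self]
  · rintro (rfl | ⟨ι₁, ι₂, b₁, b₂, a, b, rfl⟩)
    · exact R.zero_mem_periodsOfPair Y i
    · exact R.periodMatrixOfPair_mem_periodsOfPair Y i b₁ b₂ a b

variable {ι₁ ι₂ : Type*} [Fintype ι₁] [Fintype ι₂]

/-- The `σ(k)`-span of the entries of a period matrix of the pair `Y` is the `σ(k)`-span of all its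
periods, hence independent of the bases: "the period matrix depends on the choice of bases, but
the vector space `ℙ⟨V⟩` does not" (Huber–Müller-Stach 2015, Remark 9.2.2 (1); Def. 9.2.1).
[cite: HuberMullerStachPeriodsIII2015, Def. 9.2.1 and Remark 9.2.2 (1)] -/
theorem span_range_periodMatrixOfPair_eq_span_periodsOfPair (Y : SchemePair k) (i : ℕ)
    (b₁ : Module.Basis ι₁ k (R.obj Y i)) (b₂ : Module.Basis ι₂ ℚ (Y.bettiHomology σ i)) :
    Submodule.span σ.fieldRange
        (Set.range fun p : ι₁ × ι₂ ↦ R.periodMatrixOfPair σ Y i b₁ b₂ p.1 p.2) =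
      Submodule.span σ.fieldRange (R.periodsOfPair σ Y i) := by
  refine le_antisymm (Submodule.span_mono ?_)
    (Submodule.span_le.mpr (R.periodsOfPair_subset_span_periodMatrixOfPair Y i b₁ b₂))
  rintro _ ⟨p, rfl⟩
  exact R.periodMatrixOfPair_mem_periodsOfPair Y i b₁ b₂ p.1 p.2

/-- Consequently two period matrices of the same pair (with respect to different bases) span the
same `σ(k)`-subspace of `ℂ` (Huber–Müller-Stach 2015, Remark 9.2.2 (1)).
[cite: HuberMullerStachPeriodsIII2015, Remark 9.2.2 (1)] -/
theorem span_range_periodMatrixOfPair_eq {ι₁' ι₂' : Type*} [Fintype ι₁'] [Fintype ι₂']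
    (Y : SchemePair k) (i : ℕ)
    (b₁ : Module.Basis ι₁ k (R.obj Y i)) (b₂ : Module.Basis ι₂ ℚ (Y.bettiHomology σ i))
    (b₁' : Module.Basis ι₁' k (R.obj Y i)) (b₂' : Module.Basis ι₂' ℚ (Y.bettiHomology σ i)) :
    Submodule.span σ.fieldRange
        (Set.range fun p : ι₁ × ι₂ ↦ R.periodMatrixOfPair σ Y i b₁ b₂ p.1 p.2) =
      Submodule.span σ.fieldRange
        (Set.range fun p : ι₁' × ι₂' ↦ R.periodMatrixOfPair σ Y i b₁' b₂' p.1 p.2) := by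
  rw [R.span_range_periodMatrixOfPair_eq_span_periodsOfPair Y i b₁ b₂,
    R.span_range_periodMatrixOfPair_eq_span_periodsOfPair Y i b₁' b₂']

end RelativePeriodData

end Entries

/-! ### The period matrix of a pair of varieties is invertible

In Huber–Müller-Stach 2015, Def. 9.2.1 the period matrix of `V = (V_k, V_ℚ, φ_ℂ)` is the matrix of
the *isomorphism* `φ_ℂ : V_k ⊗_k ℂ → V_ℚ ⊗_ℚ ℂ` in bases of `V_k` and `V_ℚ` (so both bases have the
same size `n` and the matrix is invertible), and by §9.3.2 the periods of a pair of varieties are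
those of `H(X, D, j) ∈ (k, ℚ)-Vect`, whose `φ_ℂ` is the period isomorphism. For relative period
data the period isomorphism is recorded in pairing form as the field `isPerfPair_pairingBaseChange`
(the `ℂ`-bilinear extension of the period pairing of a pair of varieties is perfect). We derive the
matrix statements: for bases `b₁` of `Hⁱ(Y)` and `b₂` of `Hᵢ(X_σ(ℂ), D_σ(ℂ); ℚ)` the rows and the
columns of the period matrix `(∫_{b₂ b} b₁ a)_{a,b}` are linearly independent over `ℂ`; finite such
bases have the same cardinality; and a period matrix with respect to equinumerous (same index type)
bases is invertible, i.e. has non-zero determinant. -/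

section PerfectMatrix

variable {k : Type*} [Field k] (L : Type*) [Field L] [CharZero L] [Algebra k L]
  {H : Type*} [AddCommGroup H] [Module k H] {V : Type*} [AddCommGroup V] [Module ℚ V]
  {ι₁ ι₂ : Type*}

/-- Let `p : H × V → L` be a pairing (`H` over `k`, `V` over `ℚ`, `L ⊇ k` a field of characteristic
zero) whose `L`-bilinear extension `p_L : (L ⊗_k H) × (L ⊗_ℚ V) → L` is injective in the first
variable, and let `b₁`, `b₂` be bases of `H`, `V`. Then the rows `(p (b₁ a) (b₂ b))_b`, `a ∈ ι₁`, of
the matrix of `p` are linearly independent over `L`: a relation `∑ c_a p(b₁ a, b₂ b) = 0` for all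
`b` says that `p_L (∑ c_a ⊗ b₁ a)` vanishes on the `L`-basis `1 ⊗ b₂ b` of `L ⊗_ℚ V`. [folklore] -/
theorem linearIndependent_pairing_basis_of_injective (p : H →ₗ[k] V →ₗ[ℚ] L)
    (hp : Function.Injective (pairingBaseChange L p)) (b₁ : Module.Basis ι₁ k H)
    (b₂ : Module.Basis ι₂ ℚ V) :
    LinearIndependent L fun a : ι₁ ↦ fun b : ι₂ ↦ p (b₁ a) (b₂ b) := by
  rw [linearIndependent_iff']
  intro s g hg a ha
  have hx : pairingBaseChange L p (∑ a ∈ s, g a • Algebra.TensorProduct.basis L b₁ a) = 0 := by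
    refine (Algebra.TensorProduct.basis L b₂).ext fun b ↦ ?_
    have hb := congr_fun hg b
    simp only [Finset.sum_apply, Pi.smul_apply, Pi.zero_apply, smul_eq_mul] at hb
    simp only [map_sum, map_smul, LinearMap.sum_apply, LinearMap.smul_apply, LinearMap.zero_apply,
      Algebra.TensorProduct.basis_apply, pairingBaseChange_tmul, smul_eq_mul, one_mul]
    exact hb
  exact linearIndependent_iff'.mp (Algebra.TensorProduct.basis L b₁).linearIndependent s g
    (hp (by rw [hx, map_zero])) a ha

/-- Companion of `linearIndependent_pairing_basis_of_injective` for the columns: if the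
`L`-bilinear extension `p_L` is injective in the second variable then the columns
`(p (b₁ a) (b₂ b))_a`, `b ∈ ι₂`, are linearly independent over `L`. [folklore] -/
theorem linearIndependent_pairing_basis_of_injective_flip (p : H →ₗ[k] V →ₗ[ℚ] L)
    (hp : Function.Injective (pairingBaseChange L p).flip) (b₁ : Module.Basis ι₁ k H)
    (b₂ : Module.Basis ι₂ ℚ V) :
    LinearIndependent L fun b : ι₂ ↦ fun a : ι₁ ↦ p (b₁ a) (b₂ b) := by
  rw [linearIndependent_iff']
  intro s g hg b hb
  have hy : (pairingBaseChange L p).flip (∑ b ∈ s, g b • Algebra.TensorProduct.basis L b₂ b) = 0 := by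
    refine (Algebra.TensorProduct.basis L b₁).ext fun a ↦ ?_
    have ha := congr_fun hg a
    simp only [Finset.sum_apply, Pi.smul_apply, Pi.zero_apply, smul_eq_mul] at ha
    simp only [map_sum, map_smul, LinearMap.sum_apply, LinearMap.smul_apply, LinearMap.zero_apply,
      LinearMap.flip_apply, Algebra.TensorProduct.basis_apply, pairingBaseChange_tmul, smul_eq_mul,
      one_mul]
    exact ha
  exact linearIndependent_iff'.mp (Algebra.TensorProduct.basis L b₂).linearIndependent s g
    (hp (by rw [hy, map_zero])) b hb

/-- If the `L`-bilinear extension of `p : H × V → L` is perfect, the rows and the columns of the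
matrix `(p (b₁ a) (b₂ b))_{a,b}` of `p` in any bases are linearly independent over `L`. [folklore] -/
theorem linearIndependent_pairing_basis_of_isPerfPair (p : H →ₗ[k] V →ₗ[ℚ] L)
    (hp : (pairingBaseChange L p).IsPerfPair) (b₁ : Module.Basis ι₁ k H)
    (b₂ : Module.Basis ι₂ ℚ V) :
    (LinearIndependent L fun a : ι₁ ↦ fun b : ι₂ ↦ p (b₁ a) (b₂ b)) ∧
      LinearIndependent L fun b : ι₂ ↦ fun a : ι₁ ↦ p (b₁ a) (b₂ b) :=
  ⟨linearIndependent_pairing_basis_of_injective L p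
      (LinearMap.IsPerfPair.bijective_left (pairingBaseChange L p)).1 b₁ b₂,
    linearIndependent_pairing_basis_of_injective_flip L p
      (LinearMap.IsPerfPair.bijective_right (pairingBaseChange L p)).1 b₁ b₂⟩

namespace RelativePeriodData

variable {k : Type} [Field k] [CharZero k] {P : PeriodRealization k} (R : RelativePeriodData P)
  {σ : k →+* ℂ}

/-- **The rows of a period matrix of a pair of varieties are linearly independent over `ℂ`.**
For a pair of varieties `Y`, a `k`-basis `b₁` of `Hⁱ(Y)` and a `ℚ`-basis `b₂` of
`Hᵢ(X_σ(ℂ), D_σ(ℂ); ℚ)`, the rows `(∫_{b₂ b} b₁ a)_b` of the period matrix are `ℂ`-linearly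
independent: the period matrix is the matrix of the period isomorphism (Huber–Müller-Stach 2015,
Def. 9.2.1 with §9.3.2), here the perfectness `isPerfPair_pairingBaseChange` of the `ℂ`-bilinear
extension of the period pairing. [cite: HuberMullerStachPeriodsIII2015, Def. 9.2.1 and §9.3.2] -/
theorem linearIndependent_periodMatrixOfPair_row {Y : SchemePair k} (hY : Y.IsVarietyPair) (i : ℕ)
    (b₁ : Module.Basis ι₁ k (R.obj Y i)) (b₂ : Module.Basis ι₂ ℚ (Y.bettiHomology σ i)) :
    LinearIndependent ℂ (R.periodMatrixOfPair σ Y i b₁ b₂).row :=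
  (linearIndependent_pairing_basis_of_isPerfPair (AlongHom ℂ σ) (R.pairing σ Y i)
    (R.isPerfPair_pairingBaseChange σ hY i) b₁ b₂).1

/-- **The columns of a period matrix of a pair of varieties are linearly independent over `ℂ`**
(Huber–Müller-Stach 2015, Def. 9.2.1 with §9.3.2: the period matrix is the matrix of the period
isomorphism; here `isPerfPair_pairingBaseChange`). [cite: HuberMullerStachPeriodsIII2015, Def. 9.2.1 and §9.3.2] -/
theorem linearIndependent_periodMatrixOfPair_col {Y : SchemePair k} (hY : Y.IsVarietyPair) (i : ℕ)
    (b₁ : Module.Basis ι₁ k (R.obj Y i)) (b₂ : Module.Basis ι₂ ℚ (Y.bettiHomology σ i)) :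
    LinearIndependent ℂ (R.periodMatrixOfPair σ Y i b₁ b₂).col :=
  (linearIndependent_pairing_basis_of_isPerfPair (AlongHom ℂ σ) (R.pairing σ Y i)
    (R.isPerfPair_pairingBaseChange σ hY i) b₁ b₂).2

/-- Finite bases of the de Rham side `Hⁱ(Y)` and of the Betti side `Hᵢ(X_σ(ℂ), D_σ(ℂ); ℚ)` of a pair
of varieties have the same number of elements, i.e. the period matrix is square ("bases
`v₁, …, vₙ` of `V_k` and `w₁, …, wₙ` of `V_ℚ`", Huber–Müller-Stach 2015, Def. 9.2.1): its rows are
independent vectors of `ℂ^{ι₂}` and its columns independent vectors of `ℂ^{ι₁}`.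
[cite: HuberMullerStachPeriodsIII2015, Def. 9.2.1 and §9.3.2] -/
theorem card_eq_card_of_basis [Fintype ι₁] [Fintype ι₂] {Y : SchemePair k} (hY : Y.IsVarietyPair)
    (i : ℕ) (b₁ : Module.Basis ι₁ k (R.obj Y i)) (b₂ : Module.Basis ι₂ ℚ (Y.bettiHomology σ i)) :
    Fintype.card ι₁ = Fintype.card ι₂ := by
  refine le_antisymm ?_ ?_
  · simpa only [Module.finrank_fintype_fun_eq_card] using
      (R.linearIndependent_periodMatrixOfPair_row hY i b₁ b₂).fintype_card_le_finrank
  · simpa only [Module.finrank_fintype_fun_eq_card] using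
      (R.linearIndependent_periodMatrixOfPair_col hY i b₁ b₂).fintype_card_le_finrank

/-- **The period matrix of a pair of varieties is invertible**: for bases of `Hⁱ(Y)` and of
`Hᵢ(X_σ(ℂ), D_σ(ℂ); ℚ)` indexed by the same finite type, the period matrix `(∫_{b₂ b} b₁ a)_{a,b}` is
a unit of the matrix ring (Huber–Müller-Stach 2015, Def. 9.2.1: it is the matrix of the period
isomorphism `φ_ℂ`; §9.3.2). [cite: HuberMullerStachPeriodsIII2015, Def. 9.2.1 and §9.3.2] -/
theorem isUnit_periodMatrixOfPair {ι : Type*} [Fintype ι] [DecidableEq ι] {Y : SchemePair k}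
    (hY : Y.IsVarietyPair) (i : ℕ) (b₁ : Module.Basis ι k (R.obj Y i))
    (b₂ : Module.Basis ι ℚ (Y.bettiHomology σ i)) : IsUnit (R.periodMatrixOfPair σ Y i b₁ b₂) :=
  Matrix.linearIndependent_rows_iff_isUnit.mp (R.linearIndependent_periodMatrixOfPair_row hY i b₁ b₂)

/-- Equivalently, the determinant of the period matrix of a pair of varieties (with respect to
bases indexed by the same finite type) is non-zero (Huber–Müller-Stach 2015, Def. 9.2.1 and
§9.3.2). [cite: HuberMullerStachPeriodsIII2015, Def. 9.2.1 and §9.3.2] -/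
theorem det_periodMatrixOfPair_ne_zero {ι : Type*} [Fintype ι] [DecidableEq ι] {Y : SchemePair k}
    (hY : Y.IsVarietyPair) (i : ℕ) (b₁ : Module.Basis ι k (R.obj Y i))
    (b₂ : Module.Basis ι ℚ (Y.bettiHomology σ i)) : (R.periodMatrixOfPair σ Y i b₁ b₂).det ≠ 0 :=
  ((Matrix.isUnit_iff_isUnit_det _).mp (R.isUnit_periodMatrixOfPair hY i b₁ b₂)).ne_zero

end RelativePeriodData

end PerfectMatrix

/-! ### `σ(k) ⊆ ℙ^eff(k)`; reindexing and change of bases in period matrices -/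

section BasisChange

namespace RelativePeriodData

variable {k : Type} [Field k] [CharZero k] {P : PeriodRealization k} (R : RelativePeriodData P)

/-- **`k ⊆ ℙ^eff(k)`.** Every element of `k`, embedded by `σ`, is a cohomological period of `k`
along `σ`: `σ(a) = σ(a) · ∫_{[pt]} 1` on the pair `(Spec k, ∅)` (Huber–Müller-Stach 2015,
Example 9.3.3 with `n = j = 0`: the vertex `(ℙ⁰_k = Spec k, ∅, 0)` has period set `k*`; from
`ratCast_mem_cohomologicalPeriods_holds` and Remark 9.3.2, `mul_mem_cohomologicalPeriods`).
[cite: HuberMullerStachPeriodsIII2015, Example 9.3.3 (n = j = 0) and Remark 9.3.2] -/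
theorem map_mem_cohomologicalPeriods (σ : k →+* ℂ) (a : k) : σ a ∈ R.cohomologicalPeriods σ := by
  have h1 : (1 : ℂ) ∈ R.cohomologicalPeriods σ := by
    simpa only [Rat.cast_one] using R.ratCast_mem_cohomologicalPeriods_holds σ 1
  have h := R.mul_mem_cohomologicalPeriods a h1
  rwa [mul_one] at h

/-- `σ(k) ⊆ ℙ^eff(k)` as an inclusion of subsets of `ℂ` (Huber–Müller-Stach 2015, Example 9.3.3
with `n = j = 0`). [cite: HuberMullerStachPeriodsIII2015, Example 9.3.3 (n = j = 0)] -/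
theorem fieldRange_subset_cohomologicalPeriods (σ : k →+* ℂ) :
    (σ.fieldRange : Set ℂ) ⊆ R.cohomologicalPeriods σ := by
  intro x hx
  obtain ⟨a, rfl⟩ := RingHom.mem_fieldRange.mp hx
  exact R.map_mem_cohomologicalPeriods σ a

variable {σ : k →+* ℂ} {ι₁ ι₂ ι₁' ι₂' : Type*}

/-- Reindexing the bases permutes the rows and columns of the period matrix. [folklore] -/
theorem periodMatrixOfPair_reindex (Y : SchemePair k) (i : ℕ) (b₁ : Module.Basis ι₁ k (R.obj Y i))
    (b₂ : Module.Basis ι₂ ℚ (Y.bettiHomology σ i)) (e₁ : ι₁ ≃ ι₁') (e₂ : ι₂ ≃ ι₂') :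
    R.periodMatrixOfPair σ Y i (b₁.reindex e₁) (b₂.reindex e₂) =
      (R.periodMatrixOfPair σ Y i b₁ b₂).submatrix e₁.symm e₂.symm := by
  ext a b
  simp [periodMatrixOfPair, Module.Basis.reindex_apply]

/-- For a pair of varieties and *finite* bases `b₁` of `Hⁱ(Y)` and `b₂` of `Hᵢ(X_σ(ℂ), D_σ(ℂ); ℚ)`
(indexed by any finite types, necessarily of the same cardinality, `card_eq_card_of_basis`), the
Betti basis can be re-indexed by the index type of `b₁` so that the resulting square period matrix
is invertible (Huber–Müller-Stach 2015, Def. 9.2.1 with §9.3.2; `isUnit_periodMatrixOfPair`).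
[cite: HuberMullerStachPeriodsIII2015, Def. 9.2.1 and §9.3.2] -/
theorem exists_equiv_isUnit_periodMatrixOfPair [Fintype ι₁] [Fintype ι₂] [DecidableEq ι₁]
    {Y : SchemePair k} (hY : Y.IsVarietyPair) (i : ℕ) (b₁ : Module.Basis ι₁ k (R.obj Y i))
    (b₂ : Module.Basis ι₂ ℚ (Y.bettiHomology σ i)) :
    ∃ e : ι₂ ≃ ι₁, IsUnit (R.periodMatrixOfPair σ Y i b₁ (b₂.reindex e)) := by
  obtain ⟨e⟩ := Fintype.card_eq.mp (R.card_eq_card_of_basis hY i b₁ b₂).symm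
  exact ⟨e, R.isUnit_periodMatrixOfPair hY i b₁ (b₂.reindex e)⟩

/-- **Change of bases in the period matrix.** If `b₁, b₁'` are `k`-bases of `Hⁱ(Y)` (with `b₁`
finite) and `b₂, b₂'` are `ℚ`-bases of `Hᵢ(X_σ(ℂ), D_σ(ℂ); ℚ)` (with `b₂` finite), then the period
matrix in the bases `b₁', b₂'` is `σ(A)ᵀ · M · B`, where `M` is the period matrix in the bases
`b₁, b₂`, `A = (b₁-coordinates of b₁' a')` is the change-of-basis matrix on the de Rham side
(entries in `k`, embedded by `σ`) and `B` the one on the Betti side (entries in `ℚ`): the period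
matrix is well defined up to these changes of bases (Huber–Müller-Stach 2015, Def. 9.2.1, "the
matrix of `φ_ℂ` in a choice of bases"; bilinearity of the period pairing, Def. 9.3.1).
[cite: HuberMullerStachPeriodsIII2015, Def. 9.2.1 and Def. 9.3.1] -/
theorem periodMatrixOfPair_eq_of_basis [Fintype ι₁] [Fintype ι₂] (Y : SchemePair k) (i : ℕ)
    (b₁ : Module.Basis ι₁ k (R.obj Y i)) (b₂ : Module.Basis ι₂ ℚ (Y.bettiHomology σ i))
    (b₁' : Module.Basis ι₁' k (R.obj Y i)) (b₂' : Module.Basis ι₂' ℚ (Y.bettiHomology σ i)) :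
    R.periodMatrixOfPair σ Y i b₁' b₂' =
      ((b₁.toMatrix b₁').map σ).transpose * R.periodMatrixOfPair σ Y i b₁ b₂ *
        (b₂.toMatrix b₂').map (Rat.cast : ℚ → ℂ) := by
  ext a' b'
  rw [show R.periodMatrixOfPair σ Y i b₁' b₂' a' b' =
      AlongHom.equiv σ (R.pairing σ Y i (b₁' a') (b₂' b')) from rfl,
    R.equiv_pairing_eq_sum_periodMatrixOfPair Y i b₁ b₂, Matrix.mul_apply, Finset.sum_comm]
  refine Finset.sum_congr rfl fun b _ ↦ ?_
  rw [Matrix.mul_apply, Finset.sum_mul]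
  refine Finset.sum_congr rfl fun a _ ↦ ?_
  simp only [Matrix.transpose_apply, Matrix.map_apply, Module.Basis.toMatrix_apply]
  ring

end RelativePeriodData

end BasisChange

/-! ### The periods of `(X, ∅)` are the periods of `X`; top-degree periods are `(2πi)ⁿ · k`

For `X` smooth projective over `k`, Huber–Müller-Stach define the periods of `X` as those of the
pair `(X, ∅)` (2017, §11.1; the pair `SchemePair.ofScheme X`). For relative period data `R` over a
period realization `P` the two available notions — `R.periodsOfPair σ (X, ∅) i` (image of the period
pairing of the pair) and `P.periodSetOf σ X i` (the numbers `φ_ℂ(iso_σ(1 ⊗ ω))`, the pairing point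
of view on `(Hⁱ_dR(X), Hⁱ_B(X_σ), iso_σ)`, 2015 Remark 9.2.2 (1)) — coincide: `⊇` is the discharged
fact `periodSetOf_subset_periodsOfPair_holds`, and `⊆` follows from the field `pairing_ofScheme`
because `Hⁱ(X, ∅) ≃ Hⁱ_dR(X)` (`absEquiv`) and `Hᵢ(X_σ(ℂ)) → Hᵢ(X_σ(ℂ), ∅)` is an isomorphism
(`relativeSingularHomology.isIso_ofAbsolute_of_isEmpty`, Hatcher §2.1).

In top degree the comparison is pinned down by the trace axiom `iso_trace`
(`tr_B ∘ iso_σ = (2πi)ⁿ · tr_dR` on `H²ⁿ`, `n = dim X`; Deligne 1982, §1) and the Weil axiom that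
both traces `H²ⁿ → k`, `H²ⁿ_B → ℚ` are isomorphisms: hence **the periods of `H²ⁿ(X)` along `σ` are
exactly the numbers `(2πi)ⁿ σ(a)`, `a ∈ k`** — for `X = ℙⁿ_k` this is Huber–Müller-Stach 2015,
Example 9.3.3: "`(ℙⁿ_k, ∅, 2j)` has period set `(2πi)ʲ k*`" (the case `j = n`), and for `n = 1`
it gives `2πi ∈ ℙ^eff(k)` (loc. cit., Example 9.1.4 with Lemma 9.3.4, Remark 9.1.2 (3)) for every
period realization and all relative period data over it. -/

section SmoothProjectivePeriods

open Literature.AlgebraicTopology.SingularHomology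
open scoped TensorProduct

namespace PeriodRealization

variable {k : Type} [Field k] [CharZero k] (P : PeriodRealization k) (σ : k →+* ℂ)

/-- The top-degree period formula. For `X` smooth projective of dimension `n`, `v ∈ H²ⁿ_dR(X)`,
`φ ∈ H²ⁿ_B(X_σ)^∨` and `u ∈ H²ⁿ_B(X_σ)` with `tr_B(u) = 1`:
`φ_ℂ(iso_σ(1 ⊗ v)) = (2πi)ⁿ · σ(tr_dR(v) · φ(u))`. Indeed `tr_B : H²ⁿ_B(X_σ) → ℚ` is an isomorphism
(Weil axiom (A) for `B.W` on the smooth projective `X_σ`), so `φ = φ(u) · tr_B`, and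
`tr_B(iso_σ(1 ⊗ v)) = (2πi)ⁿ tr_dR(v)` by `iso_trace` (Deligne 1982, §1: `H²ⁿ(X) ≅ ℚ(-n)`, the
comparison is multiplication by `(2πi)ⁿ` on the trace). [cite: Deligne1982, §1] -/
theorem equiv_dual_baseChange_iso_tmul_eq {n : ℕ} {X : SchemeOver k} (hX : IsSmoothProjective n X)
    (v : P.dR.obj X (2 * n)) (φ : Module.Dual ℚ ((P.B.comap σ).obj X (2 * n)))
    {u : (P.B.comap σ).obj X (2 * n)} (hu : (P.B.comap σ).trace X n u = 1) :
    AlongHom.equiv σ (Module.Dual.baseChange (AlongHom ℂ σ) φ (P.iso σ X (2 * n) (1 ⊗ₜ v))) =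
      (2 * Real.pi * Complex.I) ^ n * σ (P.dR.trace X n v * (φ u : k)) := by
  have hXσ : IsSmoothProjective n ((baseChangeHom σ).obj X) :=
    IsSmoothProjective.baseChangeHom_holds σ hX
  have hB : Function.Injective ((P.B.comap σ).trace X n) := (P.B.W.bijective_trace hXσ).1
  -- every top Betti class is a rational multiple of `u`, so `φ = φ u · tr_B`
  have hw : ∀ w, φ w = (P.B.comap σ).trace X n w * φ u := fun w ↦ by
    have : w = (P.B.comap σ).trace X n w • u :=
      hB (by rw [map_smul, hu, smul_eq_mul, mul_one])
    conv_lhs => rw [this]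
    rw [map_smul, smul_eq_mul]
  have hφ : ∀ y, Module.Dual.baseChange (AlongHom ℂ σ) φ y =
      (φ u : AlongHom ℂ σ) *
        Module.Dual.baseChange (AlongHom ℂ σ) ((P.B.comap σ).trace X n) y := by
    intro y
    induction y using TensorProduct.induction_on with
    | zero => rw [map_zero, map_zero, mul_zero]
    | tmul a w =>
      rw [Module.Dual.baseChange_apply_tmul, Module.Dual.baseChange_apply_tmul, hw w]
      simp only [Algebra.smul_def, map_mul, eq_ratCast]
      ring
    | add y z hy hz => rw [map_add, map_add, hy, hz, mul_add]
  -- `tr_B (iso (1 ⊗ v)) = (2πi)ⁿ tr_dR v` by `iso_trace`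
  have htr : Module.Dual.baseChange (AlongHom ℂ σ) ((P.B.comap σ).trace X n)
      (P.iso σ X (2 * n) (1 ⊗ₜ v)) = twoPiI σ ^ n * algebraMap k (AlongHom ℂ σ) (P.dR.trace X n v) := by
    rw [P.iso_trace σ hX, Module.Dual.baseChange_apply_tmul, smul_eq_mul, Algebra.smul_def, mul_one]
  have h2πi : AlongHom.equiv σ (twoPiI σ) = 2 * Real.pi * Complex.I := rfl
  rw [hφ, htr, map_mul, map_mul, map_pow, h2πi, map_ratCast, AlongHom.equiv_algebraMap, map_mul,
    map_ratCast]
  ring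

/-- **Top-degree periods of a smooth projective variety.** For `X` smooth projective of dimension
`n` over `k` (geometrically irreducible, as in `IsSmoothProjective`) and `σ : k →+* ℂ`, the periods
of `H²ⁿ(X)` along `σ` are exactly the numbers `(2πi)ⁿ σ(a)`, `a ∈ k`: `H²ⁿ_dR(X) = k · v`,
`H²ⁿ_B(X_σ) = ℚ · u` via the traces (Weil axiom (A)) and `iso_σ` is `(2πi)ⁿ` on traces
(`iso_trace`; Deligne 1982, §1). For `X = ℙⁿ_k` this is Huber–Müller-Stach 2015, Example 9.3.3
(`j = n`). [cite: HuberMullerStachPeriodsIII2015, Example 9.3.3] [cite: Deligne1982, §1] -/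
theorem periodSetOf_two_mul_eq {n : ℕ} {X : SchemeOver k} (hX : IsSmoothProjective n X) :
    P.periodSetOf σ X (2 * n) = {x | ∃ a : k, x = (2 * Real.pi * Complex.I) ^ n * σ a} := by
  have hXσ : IsSmoothProjective n ((baseChangeHom σ).obj X) :=
    IsSmoothProjective.baseChangeHom_holds σ hX
  obtain ⟨u, hu⟩ := (P.B.W.bijective_trace hXσ).2 1
  ext x
  rw [P.mem_periodSetOf_iff]
  constructor
  · rintro ⟨v, φ, rfl⟩
    exact ⟨_, P.equiv_dual_baseChange_iso_tmul_eq σ hX v φ hu⟩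
  · rintro ⟨a, rfl⟩
    obtain ⟨v, hv⟩ := (P.dR.bijective_trace hX).2 a
    refine ⟨v, (P.B.comap σ).trace X n, ?_⟩
    rw [P.equiv_dual_baseChange_iso_tmul_eq σ hX v _ hu, hv]
    change _ = _ * σ (a * ((P.B.W.trace ((baseChangeHom σ).obj X) n u : ℚ) : k))
    rw [hu, Rat.cast_one, mul_one]

/-- **Huber–Müller-Stach 2015, Example 9.3.3** (`j = n`) for the period realization `P`: the
periods of `H²ⁿ(ℙⁿ_k)` along `σ` are the numbers `(2πi)ⁿ σ(a)`, `a ∈ k` ("`(ℙⁿ_k, ∅, 2j)` has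
period set `(2πi)ʲ k*`"). [cite: HuberMullerStachPeriodsIII2015, Example 9.3.3] -/
theorem periodSetOf_projectiveSpace_eq (n : ℕ) :
    P.periodSetOf σ (projectiveSpace n k) (2 * n) =
      {x | ∃ a : k, x = (2 * Real.pi * Complex.I) ^ n * σ a} :=
  P.periodSetOf_two_mul_eq σ (isSmoothProjective_projectiveSpace_holds k n)

/-- `(2πi)ⁿ σ(a)` is a period of `H²ⁿ(ℙⁿ_k)` along `σ`, for every `a ∈ k` (Huber–Müller-Stach
2015, Example 9.3.3). [cite: HuberMullerStachPeriodsIII2015, Example 9.3.3] -/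
theorem twoPiI_pow_mul_mem_periodSetOf_projectiveSpace (n : ℕ) (a : k) :
    (2 * Real.pi * Complex.I) ^ n * σ a ∈ P.periodSetOf σ (projectiveSpace n k) (2 * n) := by
  rw [P.periodSetOf_projectiveSpace_eq σ n]
  exact ⟨a, rfl⟩

end PeriodRealization

namespace RelativePeriodData

variable {k : Type} [Field k] [CharZero k] {P : PeriodRealization k} (R : RelativePeriodData P)
  (σ : k →+* ℂ)

/-- For `X` smooth projective, every period of the pair `(X, ∅)` is a period of `X` in the sense of
`P` (the converse of `periodSetOf_subset_periodsOfPair_holds`): by `pairing_ofScheme`,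
`∫_γ ω = ⟨iso_σ(1 ⊗ absEquiv ω), γ₀⟩` where `γ = j_*γ₀`, `j_* : Hᵢ(X_σ(ℂ)) ⥲ Hᵢ(X_σ(ℂ), ∅)`
(Hatcher 2002, §2.1; `relativeSingularHomology.isIso_ofAbsolute_of_isEmpty`), and
`⟨-, γ₀⟩ ∘ isoObj ∈ Hⁱ_B(X_σ)^∨` (Huber–Müller-Stach 2017, §11.1: the periods of `X` are the
periods of the pair `(X, ∅)`; 2015, Remark 9.2.2 (1) and Def. 9.3.1).
[cite: HuberMullerStachPeriodsIII2015, Remark 9.2.2 (1) and Def. 9.3.1] -/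
theorem periodsOfPair_ofScheme_subset_periodSetOf {n : ℕ} {X : SchemeOver k}
    (hX : IsSmoothProjective n X) (i : ℕ) :
    R.periodsOfPair σ (SchemePair.ofScheme X) i ⊆ P.periodSetOf σ X i := by
  rintro _ ⟨ω, γ, rfl⟩
  -- `ω = absEquiv⁻¹ v`
  obtain ⟨v, rfl⟩ : ∃ v, (R.absEquiv X i).symm v = ω :=
    ⟨R.absEquiv X i ω, (R.absEquiv X i).symm_apply_apply ω⟩
  -- `D = ∅`, so `γ = j_* γ₀` for an absolute class `γ₀`
  haveI : IsEmpty ↥((SchemePair.ofScheme X).complexPointsSub σ) :=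
    Set.isEmpty_coe_sort.mpr (SchemePair.complexPointsSub_ofScheme σ X)
  haveI := relativeSingularHomology.isIso_ofAbsolute_of_isEmpty ℚ ℚ
    ((SchemePair.ofScheme X).complexPointsSub σ) i
  obtain ⟨γ₀, rfl⟩ := (asIso (relativeSingularHomology.ofAbsolute ℚ ℚ _
      ((SchemePair.ofScheme X).complexPointsSub σ) i)).toLinearEquiv.surjective γ
  refine P.mem_periodSetOf_iff.mpr ⟨v,
    (kroneckerPairing ℚ ℚ (ComplexPoints ((baseChangeHom σ).obj X)) i).flip γ₀ ∘ₗ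
      (P.B.isoObj ((baseChangeHom σ).obj X) i).toLinearMap, ?_⟩
  change AlongHom.equiv σ (R.pairing σ (SchemePair.ofScheme X) i ((R.absEquiv X i).symm v)
    ((relativeSingularHomology.ofAbsolute ℚ ℚ (ComplexPoints ((baseChangeHom σ).obj X))
      ((SchemePair.ofScheme X).complexPointsSub σ) i).hom γ₀)) = _
  rw [R.pairing_ofScheme σ hX i v γ₀]
  rfl

/-- **The periods of the pair `(X, ∅)` are the periods of `X`** for `X` smooth projective: the
image of the period pairing of `(X, ∅)` equals the set of numbers `φ_ℂ(iso_σ(1 ⊗ ω))`,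
`ω ∈ Hⁱ_dR(X)`, `φ ∈ Hⁱ_B(X_σ)^∨` (Huber–Müller-Stach 2017, §11.1; 2015, Remark 9.2.2 (1): the
periods of `V ∈ (k, ℚ)-Vect` are the values of the associated pairing; Def. 9.3.1 and §9.3.2,
`ℙ(X, D, j) = ℙ(H(X, D, j))`). [cite: HuberMullerStachPeriodsIII2015, Remark 9.2.2 (1), Def. 9.3.1 and §9.3.2] -/
theorem periodsOfPair_ofScheme_eq_periodSetOf {n : ℕ} {X : SchemeOver k}
    (hX : IsSmoothProjective n X) (i : ℕ) :
    R.periodsOfPair σ (SchemePair.ofScheme X) i = P.periodSetOf σ X i :=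
  (R.periodsOfPair_ofScheme_subset_periodSetOf σ hX i).antisymm
    (R.periodSetOf_subset_periodsOfPair_holds σ hX i)

/-- **Top-degree periods of a pair `(X, ∅)`**, `X` smooth projective of dimension `n`: the period
set `ℙ((X, ∅), 2n)` along `σ` is `{(2πi)ⁿ σ(a) | a ∈ k}` (Huber–Müller-Stach 2015, Example 9.3.3
for `X = ℙⁿ`; in general from `iso_trace`, Deligne 1982, §1).
[cite: HuberMullerStachPeriodsIII2015, Example 9.3.3] [cite: Deligne1982, §1] -/
theorem periodsOfPair_ofScheme_two_mul_eq {n : ℕ} {X : SchemeOver k}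
    (hX : IsSmoothProjective n X) :
    R.periodsOfPair σ (SchemePair.ofScheme X) (2 * n) =
      {x | ∃ a : k, x = (2 * Real.pi * Complex.I) ^ n * σ a} := by
  rw [R.periodsOfPair_ofScheme_eq_periodSetOf σ hX, P.periodSetOf_two_mul_eq σ hX]

/-- **Huber–Müller-Stach 2015, Example 9.3.3** (`j = n`): for every period realization `P` of `k`
and all relative period data `R` over `P`, the period set of the vertex `(ℙⁿ_k, ∅, 2n)` along
`σ` is `{(2πi)ⁿ σ(a) | a ∈ k}` = `(2πi)ⁿ k*` together with `0`.
[cite: HuberMullerStachPeriodsIII2015, Example 9.3.3] -/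
theorem periodsOfPair_projectiveSpace_eq (n : ℕ) :
    R.periodsOfPair σ (SchemePair.ofScheme (projectiveSpace n k)) (2 * n) =
      {x | ∃ a : k, x = (2 * Real.pi * Complex.I) ^ n * σ a} :=
  R.periodsOfPair_ofScheme_two_mul_eq σ (isSmoothProjective_projectiveSpace_holds k n)

/-- `(2πi)ⁿ σ(a) ∈ ℙ^eff(k)` for all `n : ℕ`, `a ∈ k`: it is a period of the pair of varieties
`(ℙⁿ_k, ∅)` in degree `2n` (Huber–Müller-Stach 2015, Example 9.3.3, with
`IsSmoothProjective.isVarietyPair_ofScheme_holds`). [cite: HuberMullerStachPeriodsIII2015, Example 9.3.3] -/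
theorem twoPiI_pow_mul_mem_cohomologicalPeriods (n : ℕ) (a : k) :
    (2 * Real.pi * Complex.I) ^ n * σ a ∈ R.cohomologicalPeriods σ := by
  have hmem : (2 * Real.pi * Complex.I) ^ n * σ a ∈
      R.periodsOfPair σ (SchemePair.ofScheme (projectiveSpace n k)) (2 * n) := by
    rw [R.periodsOfPair_projectiveSpace_eq σ n]
    exact ⟨a, rfl⟩
  exact R.periodsOfPair_subset_cohomologicalPeriods
    (IsSmoothProjective.isVarietyPair_ofScheme_holds (isSmoothProjective_projectiveSpace_holds k n))
    (2 * n) hmem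

/-- `(2πi)ⁿ ∈ ℙ^eff(k)` for every `n` (Huber–Müller-Stach 2015, Example 9.3.3 with `a = 1`).
[cite: HuberMullerStachPeriodsIII2015, Example 9.3.3] -/
theorem twoPiI_pow_mem_cohomologicalPeriods (n : ℕ) :
    (2 * Real.pi * Complex.I) ^ n ∈ R.cohomologicalPeriods σ := by
  simpa only [map_one, mul_one] using R.twoPiI_pow_mul_mem_cohomologicalPeriods σ n 1

/-- **`2πi` is a cohomological period of every field `k` along every embedding**, for every
period realization and all relative period data over it: `2πi ∈ ℙ((ℙ¹_k, ∅), 2)`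
(Huber–Müller-Stach 2015, Example 9.1.4, `∫_{S¹} dt/t = 2πi`, with Lemma 9.3.4
`ℙ_nc^eff(k) ⊆ ℙ^eff(k)`; Example 9.3.3; here from the trace compatibility `iso_trace` of `P` on
`H²(ℙ¹)`, Deligne 1982, §1). [cite: HuberMullerStachPeriodsIII2015, Example 9.1.4 and Example 9.3.3] -/
theorem twoPiI_mem_cohomologicalPeriods : 2 * Real.pi * Complex.I ∈ R.cohomologicalPeriods σ := by
  simpa only [pow_one] using R.twoPiI_pow_mem_cohomologicalPeriods σ 1

end RelativePeriodData


/-! ### `ℚ̄ ⊆ ℙ^eff(k)` and `π ∈ ℙ^eff(k)` for `k` algebraically closed (e.g. `k = ℚ̄`) -/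

/-- If `K` is an algebraically closed field of characteristic zero and `σ : K →+* ℂ` a ring
homomorphism, every complex number algebraic over `ℚ` lies in the image of `σ` (the minimal
polynomial splits in `K` and `σ` maps its roots onto its complex roots). In particular for
`K = ℚ̄ = AlgebraicClosure ℚ` the image `σ(ℚ̄)` is the algebraic closure of `ℚ` in `ℂ`.
[folklore] -/
theorem mem_range_of_isAlgebraic {K : Type*} [Field K] [IsAlgClosed K] [CharZero K]
    (σ : K →+* ℂ) {z : ℂ} (hz : IsAlgebraic ℚ z) : z ∈ Set.range σ := by
  have hint : IsIntegral ℚ z := hz.isIntegral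
  set p : Polynomial K := (minpoly ℚ z).map (algebraMap ℚ K) with hp
  have hp0 : p ≠ 0 :=
    (Polynomial.map_ne_zero_iff (algebraMap ℚ K).injective).mpr (minpoly.ne_zero hint)
  have hσ : σ.comp (algebraMap ℚ K) = algebraMap ℚ ℂ := RingHom.ext_rat _ _
  have hroot : (p.map σ).IsRoot z := by
    change (p.map σ).eval z = 0
    rw [Polynomial.eval_map, hp, Polynomial.eval₂_map, hσ, ← Polynomial.aeval_def, minpoly.aeval]
  have hroots : p.roots.map σ = (p.map σ).roots :=
    Polynomial.roots_map_of_injective_of_card_eq_natDegree σ.injective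
      (Polynomial.splits_iff_card_roots.mp (IsAlgClosed.splits p))
  have hz' : z ∈ (p.map σ).roots :=
    (Polynomial.mem_roots ((Polynomial.map_ne_zero_iff σ.injective).mpr hp0)).mpr hroot
  rw [← hroots, Multiset.mem_map] at hz'
  obtain ⟨a, -, rfl⟩ := hz'
  exact ⟨a, rfl⟩

namespace RelativePeriodData

variable {k : Type} [Field k] [CharZero k] {P : PeriodRealization k} (R : RelativePeriodData P)
  (σ : k →+* ℂ)

/-- **`ℚ̄ ⊆ ℙ^eff(k)` for `k` algebraically closed** (e.g. `k = ℚ̄`): for every period realization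
and all relative period data over `k`, every complex number algebraic over `ℚ` is a cohomological
period along every `σ : k →+* ℂ` — it lies in `σ(k)` (`mem_range_of_isAlgebraic`), and
`σ(k) ⊆ ℙ^eff(k)` (`map_mem_cohomologicalPeriods`; Huber–Müller-Stach 2015, Example 9.1.3, "the
same method works for all algebraic numbers", with Lemma 9.3.4, and Example 9.3.3 (`n = j = 0`):
`ℙ(Spec k, ∅, 0) = k*`). [cite: HuberMullerStachPeriodsIII2015, Example 9.1.3 and Example 9.3.3] -/
theorem mem_cohomologicalPeriods_of_isAlgebraic [IsAlgClosed k] {z : ℂ} (hz : IsAlgebraic ℚ z) :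
    z ∈ R.cohomologicalPeriods σ := by
  obtain ⟨a, rfl⟩ := mem_range_of_isAlgebraic σ hz
  exact R.map_mem_cohomologicalPeriods σ a

/-- If `k` contains a square root of `-1`, then `π` is a cohomological period of `k` along every
`σ`, for every period realization and all relative period data: `π = 2πi · σ(∓j/2)` with
`σ(j) = ±i` (Huber–Müller-Stach 2015, Example 9.1.4: "in particular `π ∈ ℙ_nc^eff(k)`"; here
from `2πi ∈ ℙ((ℙ¹_k, ∅), 2)` and Remark 9.3.2). [cite: HuberMullerStachPeriodsIII2015, Example 9.1.4 and Remark 9.3.2] -/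
theorem pi_mem_cohomologicalPeriods_of_sq_eq_neg_one {j : k} (hj : j ^ 2 = -1) :
    (Real.pi : ℂ) ∈ R.cohomologicalPeriods σ := by
  -- `σ j = ± i`; choose `j'` with `σ j' = -i`, then `π = 2πi · σ (j' / 2)`
  obtain ⟨j', hj'⟩ : ∃ j' : k, σ j' = -Complex.I := by
    have h2 : σ j ^ 2 = Complex.I ^ 2 := by rw [← map_pow, hj, map_neg, map_one, Complex.I_sq]
    obtain h | h := sq_eq_sq_iff_eq_or_eq_neg.mp h2
    · exact ⟨-j, by rw [map_neg, h]⟩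
    · exact ⟨j, h⟩
  have key : (Real.pi : ℂ) = (2 * Real.pi * Complex.I) ^ 1 * σ (j' / 2) := by
    rw [map_div₀, hj', map_ofNat]
    linear_combination (Real.pi : ℂ) * Complex.I_sq
  rw [key]
  exact R.twoPiI_pow_mul_mem_cohomologicalPeriods σ 1 (j' / 2)

/-- **`π ∈ ℙ^eff(k)` for `k` algebraically closed** (e.g. `k = ℚ̄`), along every `σ`, for every
period realization and all relative period data (Huber–Müller-Stach 2015, Example 9.1.4 with
Lemma 9.3.4). [cite: HuberMullerStachPeriodsIII2015, Example 9.1.4] -/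
theorem pi_mem_cohomologicalPeriods [IsAlgClosed k] : (Real.pi : ℂ) ∈ R.cohomologicalPeriods σ := by
  obtain ⟨j, hj⟩ := IsAlgClosed.exists_pow_nat_eq (-1 : k) two_pos
  exact R.pi_mem_cohomologicalPeriods_of_sq_eq_neg_one σ hj

end RelativePeriodData


/-! ### Degree-zero periods are `σ(k)` (Huber–Müller-Stach 2015, Example 9.3.3, `j = 0`) -/

/-- In a Weil cohomology theory the unit `1 ∈ H⁰(X)` of a smooth projective variety is non-zero:
otherwise `v = 1 ∪ v = 0` for all `v ∈ H²ⁿ(X)`, contradicting the surjectivity of the trace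
(Kleiman 1968, §1.2 (A)). (The same statement is `WeilCohomology.unit_ne_zero` in
`Motives/AbelianVarietyHopf` and `CrystallineRealization.one_ne_zero_of_isSmoothProjective` in
`Motives/CrystallineRiemannRoch`, neither imported here to keep the import closure small; hence
`private`.) [cite: Kleiman1968, §1.2 (A)] -/
private theorem WeilCohomology.one_ne_zero_of_isSmoothProjective {k : Type u} [Field k] {K : Type v}
    [Field K] [CharZero K] (W : WeilCohomology k K) {n : ℕ} {X : SchemeOver k}
    (hX : IsSmoothProjective n X) : W.one X ≠ 0 := by
  intro h0
  obtain ⟨v, hv⟩ := (W.bijective_trace hX).2 1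
  have : v = 0 := by
    rw [← W.one_cup hX (zero_add (2 * n)) v, h0, map_zero, LinearMap.zero_apply]
  rw [this, map_zero] at hv
  exact zero_ne_one hv

namespace PeriodRealization

variable {k : Type} [Field k] [CharZero k] (P : PeriodRealization k) (σ : k →+* ℂ)

/-- The degree-zero period formula: for `X` smooth projective, `a ∈ k` and `φ ∈ H⁰_B(X_σ)^∨`,
`φ_ℂ(iso_σ(1 ⊗ a · 1_dR)) = σ(a · φ(1_B))`, by the unit axiom `iso_one` (`iso_σ(1 ⊗ 1) = 1 ⊗ 1`;
Grothendieck 1966, the comparison is an isomorphism of algebras). [cite: Grothendieck1966, Thm. 1'] -/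
theorem equiv_dual_baseChange_iso_zero_eq {n : ℕ} {X : SchemeOver k} (hX : IsSmoothProjective n X)
    (a : k) (φ : Module.Dual ℚ ((P.B.comap σ).obj X 0)) :
    AlongHom.equiv σ (Module.Dual.baseChange (AlongHom ℂ σ) φ
        (P.iso σ X 0 (1 ⊗ₜ (a • P.dR.one X)))) =
      σ (a * (φ ((P.B.comap σ).one X) : k)) := by
  rw [TensorProduct.tmul_smul, ← algebraMap_smul (AlongHom ℂ σ) a, map_smul, map_smul,
    P.iso_one σ hX, Module.Dual.baseChange_apply_tmul, smul_eq_mul, Algebra.smul_def, mul_one,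
    map_mul, AlongHom.equiv_algebraMap, eq_ratCast, map_ratCast, map_mul, map_ratCast]

/-- **Degree-zero periods of a smooth projective variety are `σ(k)`**: for `X` smooth projective
over `k` and `σ : k →+* ℂ`, the periods of `H⁰(X)` along `σ` are exactly the `σ(a)`, `a ∈ k`
(`H⁰_dR(X) = k · 1`, `H⁰_B(X_σ) = ℚ · 1` by Weil axiom (A), and `iso_σ(1 ⊗ 1) = 1 ⊗ 1`). For
`X = ℙⁿ_k` this is Huber–Müller-Stach 2015, Example 9.3.3 with `j = 0`: "`(ℙⁿ_k, ∅, 0)` has period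
set `k*`". [cite: HuberMullerStachPeriodsIII2015, Example 9.3.3] -/
theorem periodSetOf_zero_eq {n : ℕ} {X : SchemeOver k} (hX : IsSmoothProjective n X) :
    P.periodSetOf σ X 0 = Set.range σ := by
  have hXσ : IsSmoothProjective n ((baseChangeHom σ).obj X) :=
    IsSmoothProjective.baseChangeHom_holds σ hX
  -- `H⁰_dR(X) = k · 1` and `H⁰_B(X_σ) = ℚ · 1`
  have h1dR : ∀ v : P.dR.obj X 0, ∃ a : k, a • P.dR.one X = v :=
    (finrank_eq_one_iff_of_nonzero' _
      (P.dR.one_ne_zero_of_isSmoothProjective hX)).mp (P.dR.finrank_obj_zero hX)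
  haveI : Module.Finite ℚ ((P.B.comap σ).obj X 0) := P.B.W.finite_obj hXσ 0
  have hB1 : Module.finrank ℚ ((P.B.comap σ).obj X 0) = 1 := P.B.W.finrank_obj_zero hXσ
  have hBne : (P.B.comap σ).one X ≠ 0 := P.B.W.one_ne_zero_of_isSmoothProjective hXσ
  ext x
  rw [P.mem_periodSetOf_iff]
  constructor
  · rintro ⟨v, φ, rfl⟩
    obtain ⟨a, rfl⟩ := h1dR v
    exact ⟨_, (P.equiv_dual_baseChange_iso_zero_eq σ hX a φ).symm⟩
  · rintro ⟨a, rfl⟩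
    obtain ⟨b, hb⟩ : ∃ b : Module.Basis Unit ℚ ((P.B.comap σ).obj X 0),
        b default = (P.B.comap σ).one X :=
      ⟨FiniteDimensional.basisSingleton Unit hB1 _ hBne,
        FiniteDimensional.basisSingleton_apply _ _ _ _ _⟩
    refine ⟨a • P.dR.one X, b.coord default, ?_⟩
    rw [P.equiv_dual_baseChange_iso_zero_eq σ hX a, Module.Basis.coord_apply, ← hb, b.repr_self,
      Finsupp.single_eq_same, Rat.cast_one, mul_one]

/-- Huber–Müller-Stach 2015, Example 9.3.3 with `j = 0`, for the period realization `P`: the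
periods of `H⁰(ℙⁿ_k)` along `σ` are the `σ(a)`, `a ∈ k`. [cite: HuberMullerStachPeriodsIII2015, Example 9.3.3] -/
theorem periodSetOf_projectiveSpace_zero_eq (n : ℕ) :
    P.periodSetOf σ (projectiveSpace n k) 0 = Set.range σ :=
  P.periodSetOf_zero_eq σ (isSmoothProjective_projectiveSpace_holds k n)

end PeriodRealization

namespace RelativePeriodData

variable {k : Type} [Field k] [CharZero k] {P : PeriodRealization k} (R : RelativePeriodData P)
  (σ : k →+* ℂ)

/-- **Degree-zero periods of a pair `(X, ∅)`**, `X` smooth projective: `ℙ((X, ∅), 0) = σ(k)`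
(Huber–Müller-Stach 2015, Example 9.3.3 with `j = 0` for `X = ℙⁿ`; for `X = Spec k = ℙ⁰` cf.
`ratCast_mem_cohomologicalPeriods_holds`). [cite: HuberMullerStachPeriodsIII2015, Example 9.3.3] -/
theorem periodsOfPair_ofScheme_zero_eq {n : ℕ} {X : SchemeOver k} (hX : IsSmoothProjective n X) :
    R.periodsOfPair σ (SchemePair.ofScheme X) 0 = Set.range σ := by
  rw [R.periodsOfPair_ofScheme_eq_periodSetOf σ hX, P.periodSetOf_zero_eq σ hX]

/-- **Huber–Müller-Stach 2015, Example 9.3.3** (`j = 0`): for every period realization and all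
relative period data, the period set of the vertex `(ℙⁿ_k, ∅, 0)` along `σ` is `σ(k)` (= `k*`
together with `0`). [cite: HuberMullerStachPeriodsIII2015, Example 9.3.3] -/
theorem periodsOfPair_projectiveSpace_zero_eq (n : ℕ) :
    R.periodsOfPair σ (SchemePair.ofScheme (projectiveSpace n k)) 0 = Set.range σ :=
  R.periodsOfPair_ofScheme_zero_eq σ (isSmoothProjective_projectiveSpace_holds k n)

/-- The period set of the point `(Spec k, ∅)` in degree `0` is `σ(k)` (Huber–Müller-Stach 2015,
Example 9.3.3 with `n = j = 0`, `ℙ⁰_k = Spec k`; refines `ratCast_mem_cohomologicalPeriods_holds`).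
[cite: HuberMullerStachPeriodsIII2015, Example 9.3.3] -/
theorem periodsOfPair_unit_zero_eq :
    R.periodsOfPair σ (SchemePair.ofScheme (𝟙_ (SchemeOver k))) 0 = Set.range σ :=
  R.periodsOfPair_ofScheme_zero_eq σ (isSmoothProjective_unit_holds k)

end RelativePeriodData

end SmoothProjectivePeriods

end Literature.AlgebraicGeometry.Motives
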